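import Literature.Topology.FourManifolds.DehnSurgeryTubularNbhdProofs
import Literature.Topology.FourManifolds.SurfaceCapping
import Literature.Topology.FourManifolds.SliceGenus
import Literature.Topology.FourManifolds.ImmersionCriterion
import Literature.Topology.FourManifolds.LevelTranslation
import Literature.Topology.FourManifolds.SchoenfliesTools
import Literature.Topology.FourManifolds.InverseFunctionTheorem
import Literature.Analysis.Calculus.SeeleyExtension
import Mathlib.Analysis.SpecialFunctions.SmoothTransition
import Mathlib.LinearAlgebra.CrossProduct
import HarnessLib

/-!
# The tubular neighbourhood of a knot adapted to a Seifert surface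

Topic `Literature/Topology/FourManifolds`; fact seat
`provefact-Literature.Topology.FourManifolds.isUnknot_of_isIntegralSurgery_zero` (Property R,
D. Gabai, *Foliations and the topology of 3-manifolds. III*, J. Differential Geom. 26 (1987),
Cor. 8.3 and Remark 8.5). Third **proved** brick of the printed line, after
`DehnSurgeryHomology.lean` (Def. 8.1: zero frame surgery is a homology `S² × S¹`) and
`SeifertFramingZero.lean` (Def. 8.1: the Seifert longitude is null-homologous). Gabai's
Corollary 8.2 caps a Seifert surface `S` of `k` off in the zero frame surgery `M`:
*"`Ŝ - N̊(k) = S` … Cap off `S` by a disc to create `Ŝ`"* (p. 525). This presupposes that `S`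
meets the tubular neighbourhood `N(k)` of the surgery in a collar of `∂S = k`, i.e. that `S` is in
**normal position** with respect to `N(k)`; this file supplies the differential-topological
half of that normalisation: **for every Seifert surface `F : S ↪ 𝕊³` of `K` there is an oriented
tubular neighbourhood `ν` of `K` (`Knot.TubularNbhd`, the structure of integral Dehn surgery,
`DehnSurgery.lean`) whose positive `e₀`-half-planes are the collar of `K` in `F(S)`**
(`Knot.IsSpanningSurfaceOfGenus.adaptedTube`, `adaptedTube_apply_single`), whose longitude runs
in `F(S)` (`coe_longitude_adaptedTube`; so `ν` has framing `0` by `SeifertFramingZero.lean`), and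
such that in a thin tube about `K` the surface is *exactly* those half-planes
(`exists_radius_forall_eq_single`, `exists_radius_forall_ne`). The remaining half — transporting
`F` along the ambient diffeomorphism matching `ν` with the given `0`-framed tube of the surgery
(uniqueness of framed tubes, `Knot.TubularNbhd.exists_diffeomorph_eq_of_hasFraming`) — is the
sequel.

This is Hirsch's construction of a tubular neighbourhood (Hirsch, *Differential Topology* (1976),
Ch. 4 §5, Thms. 5.1–5.2: the map `(x, y) ↦ x + y` on a field of planes transverse to the
submanifold is a local diffeomorphism near the zero section by the inverse function theorem,
injective near it by compactness, and a partial tube is squeezed to a full one; §6 for neat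
submanifolds with boundary) exactly as carried out for knots in
`DehnSurgeryTubularNbhdProofs.lean`, but over a frame adapted to the surface: the velocity `γ'`
of the knot, the **conormal** `∂_t A (0, θ)` of the surface (the collar direction), and their
natural normal in `T𝕊³`.

## Construction

* **The collar sheet** (`Knot.IsSpanningSurfaceOfGenus.sheet`). Let `c : CapData S` be capping
  data (long open collar `c.CS : ∂S × [0, ∞) → S`; `SurfaceCapping.lean`) and `e : ∂S ≃ₜ 𝕊¹` the
  boundary identification of the Seifert surface (`F = K ∘ e` on `∂S`). Since `K` is a smooth
  embedding `𝕊¹ ↪ ℝ⁴` and `F|∂S` is smooth with injective differential, `e` is smooth with injective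
  differential (`contMDiff_of_comp_isSmoothEmbedding`, Lee 2013 Thm. 5.27/Cor. 5.30), hence a
  diffeomorphism (`boundaryDiffeomorph`: inverse function theorem and
  `IsLocalDiffeomorph.diffeomorphOfBijective`). The **half-sheet**
  `(t, θ) ↦ F (CS (e⁻¹ (e^{iθ}), t))` is smooth on the closed half plane `[0, ∞) × ℝ` (within); by
  **Seeley's extension theorem** (R. T. Seeley, Proc. AMS 15 (1964) 625–626, proved in the tree:
  `Literature.Analysis.Calculus.Seeley.contDiffOn_extend`) it extends to a smooth `2π`-periodic
  sheet `A` on `(-∞, 1) × ℝ` with `A (0, θ) = K (e^{iθ})` and `‖A‖ = 1` on `t ≥ 0`. **`A` is an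
  immersion along the knot** (`fderiv_sheet_injective`): on the half plane it is
  `F ∘ collar ∘ (t, θ) ↦ (z θ, t)`, whose within-differential is the composite of three injective
  maps (the collar has the smooth left inverse `(proj, height)` on its open region), and
  within-differentials on the half plane are unique.
* **Collar sheets and their tubes** (`SphereEmbedding.CollarSheet`, the generic part). For a
  smooth periodic sheet `A` through the knot, on `𝕊³` for `t ≥ 0`, immersive along `t = 0`: the
  conormal `∂_t A (0, θ)` is tangent to the sphere (one-sided derivative of `‖A‖ = 1`) and
  independent of `γ'`, so in the parallelisation of `𝕊³` their frame coordinates `v, τ ∈ ℝ³` have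
  `v × τ ≠ 0` and `N = Σ (v × τ)ᵢ Xᵢ` completes a frame with `det (γ, γ', ∂_t A, N) = ‖v × τ‖² > 0`
  (`frameDet_curve_tangent_conormal_normal_pos`). The **raw tube**
  `(θ, w) ↦ γ θ + χ_η (w₀) (A (w₀, θ) - γ θ) + w₁ N θ` (`χ_η` a plateauCut cutoff at the *closeness
  height* `η`, within which `‖A - γ‖ < 1/2`, so the raw tube stays in `⟪·, γ⟫ ≥ 1/2`) retracted to
  the sphere is a smooth periodic map `ℝ × ℝ² → 𝕊³` equal to `γ` on the zero section, equal to the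
  sheet on `{w₁ = 0, 0 ≤ w₀ ≤ η/2}` (`tube_single_zero`), with positive Jacobian frame on the zero
  section (`tubeFrameDet_tube_zero_pos`); the rest — radius of positive Jacobian, lift to
  `𝕊¹ × ℝ²`, injectivity radius, squeeze, smooth embedding, orientation — is the pipeline of
  `DehnSurgeryTubularNbhdProofs.lean` verbatim (`CollarSheet.tubularNbhd`), and on the positive
  `w₀`-axis the squeeze reparametrises the height by `ρ (x) = δ x / √(1 + x²)`
  (`tubularNbhd_circlePoint_single_zero`).
* **Thin tubes.** Off an open sub-collar the surface is a compact set missing the knot, so it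
  misses a thin tube (tube lemma); inside a thin tube every surface point is a collar point, hence
  a point of a positive half-plane (`exists_radius_forall_eq_single`).

## Main results (all proved; no named facts)

* `Knot.IsSpanningSurfaceOfGenus.boundaryDiffeomorph` — the boundary identification of a Seifert
  surface is a diffeomorphism `∂S ≅ 𝕊¹`;
* `Knot.IsSpanningSurfaceOfGenus.fderiv_sheet_injective` — the (Seeley-extended) collar sheet is
  an immersion along the knot;
* `SphereEmbedding.CollarSheet.tubularNbhd`, `tubularNbhd_circlePoint_single_zero` — the oriented
  tubular neighbourhood over a collar sheet and its half-plane property;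
* `Knot.IsSpanningSurfaceOfGenus.adaptedTube`, `adaptedTube_apply_single`,
  `coe_longitude_adaptedTube`, `exists_radius_forall_ne`, `exists_radius_forall_eq_single` — **the
  tube adapted to a Seifert surface** and its normal-position properties.

## References

* D. Gabai, *Foliations and the topology of 3-manifolds. III*, J. Differential Geom. 26 (1987)
  479–536, Def. 8.1, Cor. 8.2 and its proof (pp. 524–525). [GabaiJDG1987]
* M. W. Hirsch, *Differential Topology*, GTM 33 (1976), Ch. 4 §5 Thms. 5.1–5.2, §6 (collars,
  tubular neighbourhoods of neat submanifolds). [Hirsch1976]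
* R. T. Seeley, *Extension of `C^∞` functions defined in a half space*, Proc. Amer. Math. Soc.
  15 (1964) 625–626. [Seeley1964]
* J. M. Lee, *Introduction to Smooth Manifolds*, 2nd ed. (2013), Thm. 4.5 (inverse function
  theorem), Thm. 5.27, Cor. 5.30. [LeeSmoothManifolds2013]
* P. Cromwell, *Knots and Links* (2004), Thm. 5.8.1 (proof: a spanning surface meets `∂V` in
  preferred longitudes). [Cromwell2004]

## Design notes

* The generic part is phrased for a `SphereEmbedding 1 3` and a `CollarSheet` so that other
  sheets through a knot (e.g. slice discs meeting `𝕊³` in a collar) can reuse it; the Seifert part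
  produces a `CollarSheet` from `Knot.IsSpanningSurfaceOfGenus` data and *any* capping data `c`,
  so that the collar loops of `SeifertFramingZero.lean` (taken in `c.CS`) are literally longitudes.
* The sheet is parametrised by `(t, θ)` (height first) to match Seeley's `(t, x)`; tubes by
  `(θ, w)` as in `DehnSurgeryTubularNbhdProofs.lean`. The adapted tube is positively oriented by
  construction (no fibre reflection is needed).
* No `sorry`, no new instances; local notations `𝔼 n`, `𝕊 n`, `𝓘₁₂` as in the sibling files.
-/

open scoped Manifold ContDiff Topology RealInnerProductSpace Matrix
open Function Set Module

noncomputable section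

namespace Literature.Topology.FourManifolds

/-- Local notation: `𝔼 n` is the model Euclidean space `EuclideanSpace ℝ (Fin n)`. -/
local notation "𝔼 " n:arg => EuclideanSpace ℝ (Fin n)

/-- Local notation: `𝕊 n` is the unit sphere in `EuclideanSpace ℝ (Fin (n + 1))`. -/
local notation "𝕊 " n:arg => (Metric.sphere (0 : EuclideanSpace ℝ (Fin (n + 1))) 1)

attribute [local instance] fact_finrank_euclideanSpace_two fact_finrank_euclideanSpace_four

/-! ### A smooth plateauCut cutoff -/

section Cutoff

/-- **Plateau cutoff** `χ_η : ℝ → [0, 1]`: smooth, `= 1` on `[-η/2, η/2]`, `= 0` outside `(-η, η)`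
(product of two `Real.smoothTransition` ramps). [folklore] -/
def plateauCut (η t : ℝ) : ℝ :=
  Real.smoothTransition (2 / η * (η - t)) * Real.smoothTransition (2 / η * (η + t))

/-- The plateauCut cutoff is smooth. [folklore] -/
theorem contDiff_plateauCut (η : ℝ) : ContDiff ℝ ∞ (plateauCut η) :=
  (Real.smoothTransition.contDiff.comp (contDiff_const.mul (contDiff_const.sub contDiff_id))).mul
    (Real.smoothTransition.contDiff.comp (contDiff_const.mul (contDiff_const.add contDiff_id)))

/-- The plateauCut cutoff is `1` on `[-η/2, η/2]`. [folklore] -/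
theorem plateauCut_of_abs_le {η t : ℝ} (hη : 0 < η) (ht : |t| ≤ η / 2) : plateauCut η t = 1 := by
  rw [abs_le] at ht
  have key : ∀ s : ℝ, η / 2 ≤ s → 1 ≤ 2 / η * s := fun s hs ↦ by
    calc (1 : ℝ) = 2 / η * (η / 2) := by field_simp
      _ ≤ 2 / η * s := mul_le_mul_of_nonneg_left hs (by positivity)
  rw [plateauCut, Real.smoothTransition.one_of_one_le (key _ (by linarith)),
    Real.smoothTransition.one_of_one_le (key _ (by linarith)), one_mul]

/-- The plateauCut cutoff vanishes outside `(-η, η)`. [folklore] -/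
theorem plateauCut_of_le_abs {η t : ℝ} (hη : 0 < η) (ht : η ≤ |t|) : plateauCut η t = 0 := by
  rcases le_abs'.1 ht with h | h
  · have h0 : 2 / η * (η + t) ≤ 0 := mul_nonpos_of_nonneg_of_nonpos (by positivity) (by linarith)
    rw [plateauCut, Real.smoothTransition.zero_of_nonpos h0, mul_zero]
  · have h0 : 2 / η * (η - t) ≤ 0 := mul_nonpos_of_nonneg_of_nonpos (by positivity) (by linarith)
    rw [plateauCut, Real.smoothTransition.zero_of_nonpos h0, zero_mul]

/-- The plateauCut cutoff at `0` is `1`. [folklore] -/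
@[simp] theorem plateauCut_zero {η : ℝ} (hη : 0 < η) : plateauCut η 0 = 1 :=
  plateauCut_of_abs_le hη (by rw [abs_zero]; positivity)

/-- The plateauCut cutoff is locally constant (`= 1`) near `0`, hence has derivative `0` there.
[folklore] -/
theorem hasDerivAt_plateauCut_zero {η : ℝ} (hη : 0 < η) : HasDerivAt (plateauCut η) 0 0 := by
  have h : (plateauCut η) =ᶠ[𝓝 0] fun _ ↦ (1 : ℝ) := by
    have hmem : Ioo (-(η / 2)) (η / 2) ∈ 𝓝 (0 : ℝ) := Ioo_mem_nhds (by linarith) (by linarith)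
    filter_upwards [hmem] with t ht
    exact plateauCut_of_abs_le hη (abs_le.2 ⟨ht.1.le, ht.2.le⟩)
  exact (hasDerivAt_const (0 : ℝ) (1 : ℝ)).congr_of_eventuallyEq h

end Cutoff

/-! ### Linear algebra of the frame at a point of `𝕊³` -/

section Frame

/-- `frameComb p` is additive in the coefficient vector. [folklore] -/
theorem frameComb_add (p : 𝔼 4) (a b : Fin 3 → ℝ) :
    frameComb p (a + b) = frameComb p a + frameComb p b := by
  ext j; simp [frameComb_apply]; ring

/-- `frameComb p` is homogeneous in the coefficient vector. [folklore] -/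
theorem frameComb_smul (p : 𝔼 4) (c : ℝ) (a : Fin 3 → ℝ) :
    frameComb p (c • a) = c • frameComb p a := by
  ext j; simp [frameComb_apply]; ring

/-- `det (v, τ, v × τ) = ‖v × τ‖²` (as a dot product). [folklore] -/
theorem det_self_self_cross (v τ : Fin 3 → ℝ) :
    Matrix.det ![v, τ, v ⨯₃ τ] = (v ⨯₃ τ) ⬝ᵥ (v ⨯₃ τ) := by
  rw [Matrix.det_fin_three]
  simp [cross_apply, dotProduct, Fin.sum_univ_three]
  ring

/-- `det (v, τ, v × τ) > 0` when `v × τ ≠ 0`. [folklore] -/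
theorem det_self_self_cross_pos {v τ : Fin 3 → ℝ} (h : v ⨯₃ τ ≠ 0) :
    0 < Matrix.det ![v, τ, v ⨯₃ τ] := by
  rw [det_self_self_cross]
  have : (v ⨯₃ τ) ⬝ᵥ (v ⨯₃ τ) = (v ⨯₃ τ) 0 ^ 2 + (v ⨯₃ τ) 1 ^ 2 + (v ⨯₃ τ) 2 ^ 2 := by
    simp [dotProduct, Fin.sum_univ_three]; ring
  rw [this]
  exact sum_sq_pos_of_ne_zero h

/-- Two vectors of `ℝ³` whose only vanishing linear combination is the trivial one have non-zero
cross product. [folklore] -/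
theorem cross_ne_zero_of_forall_smul_add_smul {v τ : Fin 3 → ℝ}
    (h : ∀ a b : ℝ, a • v + b • τ = 0 → a = 0 ∧ b = 0) : v ⨯₃ τ ≠ 0 :=
  crossProduct_ne_zero_iff_linearIndependent.2 (LinearIndependent.pair_iff.2 h)

/-- **The natural normal of two tangent directions of `𝕊³`.** At a unit vector `p`, for tangent
vectors `t₁ = frameComb p v`, `t₂ = frameComb p τ` (`v`, `τ` their frame coordinates),
`N = frameComb p (v × τ)` completes `(p, t₁, t₂)` to a frame with
`det (p, t₁, t₂, N) = ‖v × τ‖²`, positive as soon as `t₁, t₂` are linearly independent. [folklore] -/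
theorem frameDet_frameComb_cross {p : 𝔼 4} (hp : ‖p‖ = 1) (v τ : Fin 3 → ℝ) :
    frameDet p (frameComb p v) (frameComb p τ) (frameComb p (v ⨯₃ τ)) =
      Matrix.det ![v, τ, v ⨯₃ τ] := by
  rw [frameDet_frameComb, hp]; ring

end Frame

/-! ### Collar sheets of a knot and their tubes -/

namespace SphereEmbedding

variable (K : SphereEmbedding 1 3)

/-- A **collar sheet** of the knot `K`: a map `A : ℝ × ℝ → ℝ⁴`, `(t, θ) ↦ A (t, θ)`, smooth on
`(-1, 1) × ℝ`, `2π`-periodic in `θ`, equal to the knot `γ θ = K (cos θ, sin θ)` for `t = 0`, with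
values on `𝕊³` for `0 ≤ t < 1`, and immersive along `t = 0`. (The half `t ≥ 0` is a collar of the
knot in a Seifert surface, parametrised by the angle of the knot and a collar height; the half
`t < 0` is a smooth extension across the boundary, e.g. Seeley's.) [folklore] -/
structure CollarSheet where
  /-- The sheet `(t, θ) ↦ A (t, θ) ∈ ℝ⁴`. -/
  A : ℝ × ℝ → 𝔼 4
  /-- The sheet is smooth for heights `t ∈ (-1, 1)`. -/
  contDiffOn_A : ContDiffOn ℝ ∞ A (Ioo (-1) 1 ×ˢ univ)
  /-- The sheet is `2π`-periodic in the angle. -/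
  periodic_A : ∀ t θ, A (t, θ + 2 * Real.pi) = A (t, θ)
  /-- At height `0` the sheet is the knot. -/
  apply_zero : ∀ θ, A (0, θ) = K.curve θ
  /-- For heights `0 ≤ t < 1` the sheet lies on `𝕊³`. -/
  norm_A : ∀ t θ, 0 ≤ t → t < 1 → ‖A (t, θ)‖ = 1
  /-- Along the knot the sheet is an immersion. -/
  fderiv_A_injective : ∀ θ, Injective (fderiv ℝ A (0, θ))

namespace CollarSheet

variable {K} (D : CollarSheet K)

/-- The smoothness domain `(-1, 1) × ℝ` of a collar sheet is open. [folklore] -/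
theorem isOpen_dom : IsOpen (Ioo (-1 : ℝ) 1 ×ˢ (univ : Set ℝ)) := isOpen_Ioo.prod isOpen_univ

/-- A collar sheet is smooth at the points of height `t ∈ (-1, 1)`. [folklore] -/
theorem contDiffAt_A {t θ : ℝ} (ht : t ∈ Ioo (-1 : ℝ) 1) : ContDiffAt ℝ ∞ D.A (t, θ) :=
  D.contDiffOn_A.contDiffAt (isOpen_dom.mem_nhds ⟨ht, mem_univ _⟩)

/-- A collar sheet is differentiable at the points of height `t ∈ (-1, 1)`. [folklore] -/
theorem hasFDerivAt_A {t θ : ℝ} (ht : t ∈ Ioo (-1 : ℝ) 1) :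
    HasFDerivAt D.A (fderiv ℝ D.A (t, θ)) (t, θ) :=
  ((D.contDiffAt_A ht).differentiableAt (by simp)).hasFDerivAt

/-- `0 ∈ (-1, 1)`. [folklore] -/
theorem zero_mem_Ioo : (0 : ℝ) ∈ Ioo (-1 : ℝ) 1 := ⟨by norm_num, by norm_num⟩

/-- The derivative of a collar sheet is smooth on its domain. [folklore] -/
theorem contDiffOn_fderiv_A : ContDiffOn ℝ ∞ (fderiv ℝ D.A) (Ioo (-1) 1 ×ˢ univ) :=
  D.contDiffOn_A.fderiv_of_isOpen isOpen_dom (by simp)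

/-- **The conormal** of a collar sheet: the derivative `∂_t A (0, θ)` across the knot (the inward
unit-speed-free normal of the knot inside the sheet). [folklore] -/
def conormal (θ : ℝ) : 𝔼 4 := fderiv ℝ D.A (0, θ) (1, 0)

/-- Unfolding of `conormal`. [folklore] -/
theorem conormal_def (θ : ℝ) : D.conormal θ = fderiv ℝ D.A (0, θ) (1, 0) := rfl

/-- Along the knot, the height derivative of the sheet is the conormal. [folklore] -/
theorem hasDerivAt_A_height (θ : ℝ) : HasDerivAt (fun t ↦ D.A (t, θ)) (D.conormal θ) 0 := by
  have hc : HasDerivAt (fun t : ℝ ↦ (t, θ)) ((1 : ℝ), (0 : ℝ)) 0 :=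
    (hasDerivAt_id (0 : ℝ)).prodMk (hasDerivAt_const (0 : ℝ) θ)
  exact (D.hasFDerivAt_A (θ := θ) zero_mem_Ioo).comp_hasDerivAt (0 : ℝ) hc

/-- **Along the knot, the angular derivative of the sheet is the velocity of the knot.**
[folklore] -/
theorem fderiv_A_zero_snd (θ : ℝ) : fderiv ℝ D.A (0, θ) (0, 1) = K.tangent θ := by
  have hc : HasDerivAt (fun θ' : ℝ ↦ ((0 : ℝ), θ')) ((0 : ℝ), (1 : ℝ)) θ :=
    (hasDerivAt_const θ (0 : ℝ)).prodMk (hasDerivAt_id θ)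
  have h1 : HasDerivAt (fun θ' ↦ D.A (0, θ')) (fderiv ℝ D.A (0, θ) (0, 1)) θ :=
    (D.hasFDerivAt_A (θ := θ) zero_mem_Ioo).comp_hasDerivAt θ hc
  have hfun : (fun θ' ↦ D.A (0, θ')) = K.curve := funext D.apply_zero
  rw [hfun] at h1
  exact h1.unique (K.hasDerivAt_curve θ)

/-- **The conormal is tangent to the sphere**: `⟪∂_t A (0, θ), γ θ⟫ = 0`, since `‖A (t, θ)‖ = 1`
for `t ≥ 0` (one-sided derivative of a constant). [folklore] -/
theorem inner_conormal_curve (θ : ℝ) : ⟪D.conormal θ, K.curve θ⟫ = 0 := by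
  have h := (D.hasDerivAt_A_height θ).norm_sq
  have h1 : HasDerivWithinAt (fun t ↦ ‖D.A (t, θ)‖ ^ 2) (2 * ⟪D.A (0, θ), D.conormal θ⟫) (Ici 0) 0 :=
    h.hasDerivWithinAt
  have h2 : HasDerivWithinAt (fun t ↦ ‖D.A (t, θ)‖ ^ 2) 0 (Ici 0) 0 := by
    refine (hasDerivWithinAt_const (0 : ℝ) (Ici (0 : ℝ)) (1 : ℝ)).congr_of_eventuallyEq ?_ ?_
    · have hmem : Ico (0 : ℝ) 1 ∈ 𝓝[Ici (0 : ℝ)] 0 := Ico_mem_nhdsGE one_pos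
      filter_upwards [hmem] with t ht
      rw [D.norm_A t θ ht.1 ht.2, one_pow]
    · rw [D.norm_A 0 θ le_rfl one_pos, one_pow]
  have huniq : UniqueDiffWithinAt ℝ (Ici (0 : ℝ)) 0 := uniqueDiffOn_Ici 0 0 self_mem_Ici
  have heq := huniq.eq_deriv _ h1 h2
  rw [D.apply_zero, real_inner_comm] at heq
  linarith

/-- **The frame coordinates of the conormal.** [folklore] -/
def coVec (θ : ℝ) : Fin 3 → ℝ := frameCoords (K.curve θ) (D.conormal θ)

/-- Unfolding of `coVec`. [folklore] -/
theorem coVec_def (θ : ℝ) : D.coVec θ = frameCoords (K.curve θ) (D.conormal θ) := rfl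

/-- The conormal is the frame combination of its frame coordinates. [folklore] -/
theorem conormal_eq_frameComb (θ : ℝ) : D.conormal θ = frameComb (K.curve θ) (D.coVec θ) :=
  eq_frameComb_frameCoords (K.norm_curve θ) (D.inner_conormal_curve θ)

/-- **Velocity and conormal are linearly independent** (in frame coordinates): the sheet is an
immersion along the knot. [folklore] -/
theorem frameVec_coVec_independent (θ : ℝ) (a b : ℝ)
    (h : a • K.frameVec θ + b • D.coVec θ = 0) : a = 0 ∧ b = 0 := by
  have h1 : a • K.tangent θ + b • D.conormal θ = 0 := by
    rw [K.tangent_eq_frameComb θ, D.conormal_eq_frameComb θ, ← frameComb_smul, ← frameComb_smul,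
      ← frameComb_add, h]
    ext j; simp [frameComb_apply]
  have h2 : fderiv ℝ D.A (0, θ) (b, a) = 0 := by
    have hba : ((b, a) : ℝ × ℝ) = b • ((1 : ℝ), (0 : ℝ)) + a • ((0 : ℝ), (1 : ℝ)) := by
      ext <;> simp
    rw [hba, map_add, map_smul, map_smul, ← conormal_def, fderiv_A_zero_snd, add_comm]
    exact h1
  have h3 : ((b, a) : ℝ × ℝ) = 0 := D.fderiv_A_injective θ (h2.trans (map_zero _).symm)
  exact ⟨(Prod.mk.inj h3).2, (Prod.mk.inj h3).1⟩

/-- The frame coordinates of the natural normal `v × τ` of the sheet. [folklore] -/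
def normalVec (θ : ℝ) : Fin 3 → ℝ := K.frameVec θ ⨯₃ D.coVec θ

/-- Unfolding of `normalVec`. [folklore] -/
theorem normalVec_def (θ : ℝ) : D.normalVec θ = K.frameVec θ ⨯₃ D.coVec θ := rfl

/-- The natural normal coordinates never vanish. [folklore] -/
theorem normalVec_ne_zero (θ : ℝ) : D.normalVec θ ≠ 0 :=
  cross_ne_zero_of_forall_smul_add_smul (D.frameVec_coVec_independent θ)

/-- **The normal field of a collar sheet** along the knot: the frame combination of `v × τ`, a
tangent vector of `𝕊³` transverse to the sheet. [folklore] -/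
def normal (θ : ℝ) : 𝔼 4 := frameComb (K.curve θ) (D.normalVec θ)

/-- Unfolding of `normal`. [folklore] -/
theorem normal_def (θ : ℝ) : D.normal θ = frameComb (K.curve θ) (D.normalVec θ) := rfl

/-- The normal field is tangent to the sphere. [folklore] -/
@[simp] theorem inner_normal_curve (θ : ℝ) : ⟪D.normal θ, K.curve θ⟫ = 0 := inner_frameComb_left _ _

/-- **The frame `(γ, γ', conormal, normal)` is positively oriented**:
`det = ‖v × τ‖² > 0`. [folklore] -/
theorem frameDet_curve_tangent_conormal_normal_pos (θ : ℝ) :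
    0 < frameDet (K.curve θ) (K.tangent θ) (D.conormal θ) (D.normal θ) := by
  rw [K.tangent_eq_frameComb θ, D.conormal_eq_frameComb θ, normal_def, normalVec_def,
    frameDet_frameComb_cross (K.norm_curve θ)]
  exact det_self_self_cross_pos (D.normalVec_ne_zero θ)

/-! #### Smoothness and periodicity of the conormal and normal fields -/

/-- The derivative of the sheet is `2π`-periodic in the angle. [folklore] -/
theorem fderiv_A_add_two_pi (t θ : ℝ) : fderiv ℝ D.A (t, θ + 2 * Real.pi) = fderiv ℝ D.A (t, θ) := by
  have hfun : D.A = fun q ↦ D.A (q + (0, 2 * Real.pi)) := by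
    funext q
    obtain ⟨t', θ'⟩ := q
    show D.A (t', θ') = D.A (t' + 0, θ' + 2 * Real.pi)
    rw [add_zero, D.periodic_A]
  conv_rhs => rw [hfun]
  rw [fderiv_comp_add_right, Prod.mk_add_mk, add_zero]

/-- The conormal is `2π`-periodic. [folklore] -/
theorem periodic_conormal : Periodic D.conormal (2 * Real.pi) := fun θ ↦ by
  rw [conormal_def, conormal_def, fderiv_A_add_two_pi]

/-- The conormal field is smooth. [folklore] -/
theorem contDiff_conormal : ContDiff ℝ ∞ D.conormal := by
  have h1 : ContDiff ℝ ∞ fun θ : ℝ ↦ fderiv ℝ D.A (0, θ) := by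
    rw [← contDiffOn_univ]
    refine D.contDiffOn_fderiv_A.comp (contDiffOn_const.prodMk contDiffOn_id) fun θ _ ↦ ?_
    exact ⟨zero_mem_Ioo, mem_univ _⟩
  exact h1.clm_apply contDiff_const

/-- The frame coordinates of the conormal are smooth. [folklore] -/
theorem contDiff_coVec : ContDiff ℝ ∞ D.coVec := contDiff_frameCoords K.contDiff_curve D.contDiff_conormal

/-- The frame coordinates of the conormal are `2π`-periodic. [folklore] -/
theorem periodic_coVec : Periodic D.coVec (2 * Real.pi) := fun θ ↦ by
  rw [coVec_def, coVec_def, K.periodic_curve, D.periodic_conormal]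

/-- The normal field is smooth. [folklore] -/
theorem contDiff_normal : ContDiff ℝ ∞ D.normal :=
  contDiff_frameComb K.contDiff_curve (contDiff_cross K.contDiff_frameVec D.contDiff_coVec)

/-- The normal field is continuous. [folklore] -/
@[continuity, fun_prop]
theorem continuous_normal : Continuous D.normal := D.contDiff_normal.continuous

/-- The normal field is `2π`-periodic. [folklore] -/
theorem periodic_normal : Periodic D.normal (2 * Real.pi) := fun θ ↦ by
  rw [normal_def, normal_def, normalVec_def, normalVec_def, K.periodic_curve, K.periodic_frameVec,
    D.periodic_coVec]

/-! #### A height `η` within which the sheet stays close to the knot -/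

/-- **Closeness height.** There is `η ∈ (0, 1/2]` such that `‖A (t, θ) - γ θ‖ < 1/2` for all
`|t| ≤ η` and all `θ` (continuity of `A` on the compact `{0} × [0, 2π]`, where `A = γ`, the tube
lemma, and periodicity). [folklore] -/
theorem exists_eta : ∃ η : ℝ, 0 < η ∧ η ≤ 1 / 2 ∧
    ∀ t θ, |t| ≤ η → ‖D.A (t, θ) - K.curve θ‖ < 1 / 2 := by
  set S : Set (ℝ × ℝ) := (Ioo (-1) 1 ×ˢ univ) ∩
    (fun q ↦ D.A q - K.curve q.2) ⁻¹' Metric.ball 0 (1 / 2) with hSdef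
  have hcont : ContinuousOn (fun q : ℝ × ℝ ↦ D.A q - K.curve q.2) (Ioo (-1) 1 ×ˢ univ) :=
    D.contDiffOn_A.continuousOn.sub (K.continuous_curve.comp continuous_snd).continuousOn
  have hS : IsOpen S := hcont.isOpen_inter_preimage isOpen_dom Metric.isOpen_ball
  have hsub : ({0} : Set ℝ) ×ˢ Icc 0 (2 * Real.pi) ⊆ S := by
    rintro ⟨t, θ⟩ ⟨ht, -⟩
    rw [mem_singleton_iff] at ht
    subst ht
    refine ⟨⟨zero_mem_Ioo, mem_univ _⟩, ?_⟩
    show D.A (0, θ) - K.curve θ ∈ Metric.ball 0 (1 / 2)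
    rw [D.apply_zero, sub_self]
    exact Metric.mem_ball_self (by norm_num)
  obtain ⟨U, V, hU, -, h0U, hIV, hUV⟩ :=
    generalized_tube_lemma isCompact_singleton isCompact_Icc hS hsub
  obtain ⟨ε, hε, hball⟩ := Metric.isOpen_iff.1 hU 0 (h0U rfl)
  refine ⟨min (ε / 2) (1 / 2), by positivity, min_le_right _ _, fun t θ ht ↦ ?_⟩
  have htU : t ∈ U := hball (by
    rw [Metric.mem_ball, dist_zero_right, Real.norm_eq_abs]
    exact ht.trans_lt ((min_le_left _ _).trans_lt (by linarith)))
  have hperA : Periodic (fun θ' ↦ D.A (t, θ') - K.curve θ') (2 * Real.pi) := fun θ' ↦ by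
    show D.A (t, θ' + 2 * Real.pi) - K.curve (θ' + 2 * Real.pi) = D.A (t, θ') - K.curve θ'
    rw [D.periodic_A, K.periodic_curve]
  obtain ⟨θ', hθ', heq⟩ := hperA.exists_mem_Ico₀ Real.two_pi_pos θ
  have hmem : (t, θ') ∈ S := hUV ⟨htU, hIV (Ico_subset_Icc_self hθ')⟩
  have h := hmem.2
  rw [mem_preimage, Metric.mem_ball, dist_zero_right] at h
  have heq' : D.A (t, θ) - K.curve θ = D.A (t, θ') - K.curve θ' := heq
  rw [heq']
  exact h

/-- **The closeness height** `η ∈ (0, 1/2]` of the sheet (`exists_eta`). [folklore] -/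
def eta : ℝ := Classical.choose D.exists_eta

/-- `0 < η`. [folklore] -/
theorem eta_pos : 0 < D.eta := (Classical.choose_spec D.exists_eta).1

/-- `η ≤ 1/2`. [folklore] -/
theorem eta_le_half : D.eta ≤ 1 / 2 := (Classical.choose_spec D.exists_eta).2.1

/-- Within height `η` the sheet is `1/2`-close to the knot. [folklore] -/
theorem norm_A_sub_curve_lt {t : ℝ} (ht : |t| ≤ D.eta) (θ : ℝ) : ‖D.A (t, θ) - K.curve θ‖ < 1 / 2 :=
  (Classical.choose_spec D.exists_eta).2.2 t θ ht

/-- Heights within `η` lie in the smoothness range `(-1, 1)`. [folklore] -/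
theorem mem_Ioo_of_abs_lt_one {t : ℝ} (ht : |t| < 1) : t ∈ Ioo (-1 : ℝ) 1 := by
  rw [abs_lt] at ht; exact ht

/-- `|t| ≤ η` implies `|t| < 1`. [folklore] -/
theorem abs_lt_one_of_le_eta {t : ℝ} (ht : |t| ≤ D.eta) : |t| < 1 :=
  ht.trans_lt (D.eta_le_half.trans_lt (by norm_num))

/-! #### The raw tube `γ + χ(w₀) (A (w₀, θ) - γ) + w₁ N` and its normalisation -/

/-- **The raw adapted tube** in coordinates: over the angle `θ` with fibre coordinate
`w = (w₀, w₁)`, the point `γ θ + χ_η(w₀) (A (w₀, θ) - γ θ) + w₁ N θ` of `ℝ⁴ ∖ 0` — the sheet in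
the half-plane direction `w₀` (cut off at height `η`), the normal field in the direction `w₁`
(Hirsch's `f (x, y) = x + y`, Thm. 5.1, before retracting to the sphere, with the sheet built
in). [folklore] -/
def rawTube (q : ℝ × 𝔼 2) : 𝔼 4 :=
  K.curve q.1 + plateauCut D.eta (q.2 0) • (D.A (q.2 0, q.1) - K.curve q.1) + q.2 1 • D.normal q.1

/-- Unfolding of `rawTube`. [folklore] -/
theorem rawTube_apply (θ : ℝ) (w : 𝔼 2) : D.rawTube (θ, w) =
    K.curve θ + plateauCut D.eta (w 0) • (D.A (w 0, θ) - K.curve θ) + w 1 • D.normal θ := rfl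

/-- The raw tube on the zero section is the knot. [folklore] -/
@[simp] theorem rawTube_zero (θ : ℝ) : D.rawTube (θ, 0) = K.curve θ := by
  rw [rawTube_apply]
  simp [D.apply_zero]

/-- The raw tube is `2π`-periodic in `θ`. [folklore] -/
theorem rawTube_add_two_pi (θ : ℝ) (w : 𝔼 2) :
    D.rawTube (θ + 2 * Real.pi, w) = D.rawTube (θ, w) := by
  rw [rawTube_apply, rawTube_apply, K.periodic_curve, D.periodic_A, D.periodic_normal]

/-- `⟪raw tube, γ⟫ = 1 + χ(w₀) (⟪A (w₀, θ), γ θ⟫ - 1)`. [folklore] -/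
theorem inner_rawTube_curve (θ : ℝ) (w : 𝔼 2) : ⟪D.rawTube (θ, w), K.curve θ⟫ =
    1 + plateauCut D.eta (w 0) * ⟪D.A (w 0, θ) - K.curve θ, K.curve θ⟫ := by
  rw [rawTube_apply, inner_add_left, inner_add_left, real_inner_smul_left, real_inner_smul_left,
    D.inner_normal_curve, mul_zero, add_zero, real_inner_self_eq_norm_sq, K.norm_curve, one_pow]

/-- **The raw tube stays in the half space `⟪·, γ θ⟫ ≥ 1/2`**, in particular it never vanishes:
where the cutoff is on, the sheet is `1/2`-close to `γ`. [folklore] -/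
theorem half_le_inner_rawTube_curve (θ : ℝ) (w : 𝔼 2) : 1 / 2 ≤ ⟪D.rawTube (θ, w), K.curve θ⟫ := by
  rw [inner_rawTube_curve]
  by_cases hw : |w 0| ≤ D.eta
  · have hb : |⟪D.A (w 0, θ) - K.curve θ, K.curve θ⟫| ≤ 1 / 2 := by
      refine (abs_real_inner_le_norm _ _).trans ?_
      rw [K.norm_curve, mul_one]
      exact (D.norm_A_sub_curve_lt hw θ).le
    have hp0 : 0 ≤ plateauCut D.eta (w 0) := mul_nonneg (Real.smoothTransition.nonneg _)
      (Real.smoothTransition.nonneg _)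
    have hp1 : plateauCut D.eta (w 0) ≤ 1 := mul_le_one₀ (Real.smoothTransition.le_one _)
      (Real.smoothTransition.nonneg _) (Real.smoothTransition.le_one _)
    rw [abs_le] at hb
    nlinarith
  · rw [plateauCut_of_le_abs D.eta_pos (not_le.1 hw).le, zero_mul, add_zero]
    norm_num

/-- The raw tube never vanishes. [folklore] -/
theorem rawTube_ne_zero (q : ℝ × 𝔼 2) : D.rawTube q ≠ 0 := by
  obtain ⟨θ, w⟩ := q
  intro h
  have := D.half_le_inner_rawTube_curve θ w
  rw [h, inner_zero_left] at this
  norm_num at this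

/-- The norm of the raw tube never vanishes. [folklore] -/
theorem norm_rawTube_ne_zero (q : ℝ × 𝔼 2) : ‖D.rawTube q‖ ≠ 0 :=
  norm_ne_zero_iff.2 (D.rawTube_ne_zero q)

/-- **The raw tube is smooth.** Near a point with `|w₀| < 1` all three summands are smooth; near
a point with `|w₀| > η` the cutoff vanishes identically and the map is `γ θ + w₁ N θ`. [folklore] -/
theorem contDiff_rawTube : ContDiff ℝ ∞ D.rawTube := by
  have hθ : ContDiff ℝ ∞ fun q : ℝ × 𝔼 2 ↦ q.1 := contDiff_fst
  have hw0 : ContDiff ℝ ∞ fun q : ℝ × 𝔼 2 ↦ q.2 0 :=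
    (EuclideanSpace.proj (0 : Fin 2) : 𝔼 2 →L[ℝ] ℝ).contDiff.comp contDiff_snd
  have hw1 : ContDiff ℝ ∞ fun q : ℝ × 𝔼 2 ↦ q.2 1 :=
    (EuclideanSpace.proj (1 : Fin 2) : 𝔼 2 →L[ℝ] ℝ).contDiff.comp contDiff_snd
  have hcurve : ContDiff ℝ ∞ fun q : ℝ × 𝔼 2 ↦ K.curve q.1 := K.contDiff_curve.comp hθ
  have hlast : ContDiff ℝ ∞ fun q : ℝ × 𝔼 2 ↦ q.2 1 • D.normal q.1 :=
    hw1.smul (D.contDiff_normal.comp hθ)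
  rw [contDiff_iff_contDiffAt]
  rintro ⟨θ, w⟩
  by_cases hw : |w 0| < 1
  · -- all summands are smooth here
    have hA : ContDiffAt ℝ ∞ (fun q : ℝ × 𝔼 2 ↦ D.A (q.2 0, q.1)) (θ, w) :=
      (D.contDiffAt_A (mem_Ioo_of_abs_lt_one hw)).comp (θ, w) (hw0.prodMk hθ).contDiffAt
    exact (hcurve.contDiffAt.add (((contDiff_plateauCut D.eta).comp hw0).contDiffAt.smul
      (hA.sub hcurve.contDiffAt))).add hlast.contDiffAt
  · -- the cutoff vanishes near `(θ, w)`
    have hη : D.eta < |w 0| := (D.eta_le_half.trans_lt (by norm_num)).trans_le (not_lt.1 hw)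
    have hev : D.rawTube =ᶠ[𝓝 (θ, w)] fun q ↦ K.curve q.1 + q.2 1 • D.normal q.1 := by
      have hopen : IsOpen {q : ℝ × 𝔼 2 | D.eta < |q.2 0|} :=
        isOpen_lt continuous_const (continuous_abs.comp hw0.continuous)
      filter_upwards [hopen.mem_nhds hη] with q hq
      obtain ⟨θ', w'⟩ := q
      rw [rawTube_apply, plateauCut_of_le_abs D.eta_pos (le_of_lt hq), zero_smul, add_zero]
    exact (hcurve.add hlast).contDiffAt.congr_of_eventuallyEq hev

/-- **The adapted tube in coordinates** `f : ℝ × ℝ² → 𝕊³ ⊆ ℝ⁴`: the raw tube retracted radially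
to the unit sphere (Hirsch's Thm. 5.2: compose with the retraction `r (x) = x / ‖x‖`). [folklore] -/
def tube (q : ℝ × 𝔼 2) : 𝔼 4 := ‖D.rawTube q‖⁻¹ • D.rawTube q

/-- Unfolding of `tube`. [folklore] -/
theorem tube_def (q : ℝ × 𝔼 2) : D.tube q = ‖D.rawTube q‖⁻¹ • D.rawTube q := rfl

/-- The tube takes values in the unit sphere. [folklore] -/
@[simp] theorem norm_tube (q : ℝ × 𝔼 2) : ‖D.tube q‖ = 1 := by
  rw [tube_def, norm_smul, norm_inv, norm_norm, inv_mul_cancel₀ (D.norm_rawTube_ne_zero q)]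

/-- The tube is smooth. [folklore] -/
theorem contDiff_tube : ContDiff ℝ ∞ D.tube :=
  ((D.contDiff_rawTube.norm ℝ D.rawTube_ne_zero).inv D.norm_rawTube_ne_zero).smul D.contDiff_rawTube

/-- The tube is differentiable. [folklore] -/
theorem differentiable_tube : Differentiable ℝ D.tube := D.contDiff_tube.differentiable (by simp)

/-- The tube is continuous. [folklore] -/
@[continuity, fun_prop]
theorem continuous_tube : Continuous D.tube := D.contDiff_tube.continuous

/-- On the zero section the tube is the knot. [folklore] -/
@[simp] theorem tube_zero (θ : ℝ) : D.tube (θ, 0) = K.curve θ := by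
  rw [tube_def, rawTube_zero, K.norm_curve, inv_one, one_smul]

/-- The tube is `2π`-periodic in `θ`. [folklore] -/
theorem tube_add_two_pi (θ : ℝ) (w : 𝔼 2) : D.tube (θ + 2 * Real.pi, w) = D.tube (θ, w) := by
  rw [tube_def, tube_def, rawTube_add_two_pi]

/-- **On the positive half of the `w₀`-axis, within height `η/2`, the tube is the sheet**:
`f (θ, (x, 0)) = A (x, θ)` for `0 ≤ x ≤ η/2`. [folklore] -/
theorem tube_single_zero {x : ℝ} (hx0 : 0 ≤ x) (hxη : x ≤ D.eta / 2) (θ : ℝ) :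
    D.tube (θ, EuclideanSpace.single 0 x) = D.A (x, θ) := by
  have hx1 : x < 1 := hxη.trans_lt (by linarith [D.eta_le_half])
  have hraw : D.rawTube (θ, EuclideanSpace.single 0 x) = D.A (x, θ) := by
    rw [rawTube_apply]
    simp only [PiLp.single_apply, if_true, show (1 : Fin 2) ≠ 0 from by decide, if_false,
      zero_smul, add_zero]
    rw [plateauCut_of_abs_le D.eta_pos (by rw [abs_of_nonneg hx0]; exact hxη), one_smul,
      add_sub_cancel]
  rw [tube_def, hraw, D.norm_A x θ hx0 hx1, inv_one, one_smul]

/-! #### The Jacobian frame of the tube on the zero section -/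

/-- The `θ`-derivative of the tube on the zero section is the velocity of the knot. [folklore] -/
theorem fderiv_tube_zero_fst (θ : ℝ) : fderiv ℝ D.tube (θ, 0) (1, 0) = K.tangent θ := by
  rw [← deriv_fst_eq_fderiv (D.differentiable_tube _)]
  simp only [tube_zero]
  rfl

/-- The fibre derivatives of the tube on the zero section, up to a multiple of the position
vector: if along the fibre line `s ↦ (θ, s eᵢ)` the raw tube is a curve `R` with `R 0 = γ θ` and
`R' (0) = N`, then `∂ᵢ f (θ, 0) = c γ θ + N`. [folklore] -/
theorem fderiv_tube_zero_snd (θ : ℝ) {i : Fin 2} {R : ℝ → 𝔼 4} {N : 𝔼 4}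
    (hR : ∀ s : ℝ, D.rawTube (θ, EuclideanSpace.single i s) = R s) (hR0 : R 0 = K.curve θ)
    (hRd : HasDerivAt R N 0) :
    ∃ c : ℝ, fderiv ℝ D.tube (θ, 0) (0, EuclideanSpace.single i 1) = c • K.curve θ + N := by
  have hR0' : R 0 ≠ 0 := by
    rw [hR0]; intro h; have := K.norm_curve θ; rw [h, norm_zero] at this; exact zero_ne_one this
  have hn : HasDerivAt (fun s : ℝ ↦ ‖R s‖) (deriv (fun s : ℝ ↦ ‖R s‖) 0) 0 :=
    (hRd.differentiableAt.norm ℝ hR0').hasDerivAt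
  have hinv := hn.fun_inv (by rw [hR0, K.norm_curve]; exact one_ne_zero)
  have hprod := hinv.fun_smul hRd
  refine ⟨-deriv (fun s : ℝ ↦ ‖R s‖) 0 / ‖R 0‖ ^ 2, ?_⟩
  rw [← deriv_snd_eq_fderiv (D.differentiable_tube _)]
  have hfun : (fun s ↦ D.tube (θ, 0 + EuclideanSpace.single i s)) = fun s ↦ ‖R s‖⁻¹ • R s := by
    funext s; rw [zero_add, tube_def, hR]
  rw [hfun, hprod.deriv, hR0, K.norm_curve, inv_one, one_smul, add_comm]

/-- Along the `w₀`-fibre line the raw tube is `γ θ + χ(s) (A (s, θ) - γ θ)`. [folklore] -/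
theorem rawTube_single_zero (θ s : ℝ) :
    D.rawTube (θ, EuclideanSpace.single 0 s) = K.curve θ + plateauCut D.eta s • (D.A (s, θ) - K.curve θ) := by
  rw [rawTube_apply]
  simp [show (1 : Fin 2) ≠ 0 from by decide]

/-- Along the `w₁`-fibre line the raw tube is `γ θ + s N θ`. [folklore] -/
theorem rawTube_single_one (θ s : ℝ) :
    D.rawTube (θ, EuclideanSpace.single 1 s) = K.curve θ + s • D.normal θ := by
  rw [rawTube_apply]
  simp [show (0 : Fin 2) ≠ 1 from by decide, D.apply_zero, plateauCut_zero D.eta_pos]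

/-- The `w₀`-fibre line of the raw tube has derivative the conormal at `s = 0`. [folklore] -/
theorem hasDerivAt_rawTube_single_zero (θ : ℝ) :
    HasDerivAt (fun s ↦ K.curve θ + plateauCut D.eta s • (D.A (s, θ) - K.curve θ)) (D.conormal θ) 0 := by
  have h1 : HasDerivAt (fun s ↦ D.A (s, θ) - K.curve θ) (D.conormal θ) 0 :=
    (D.hasDerivAt_A_height θ).sub_const _
  have h2 := (hasDerivAt_plateauCut_zero D.eta_pos).smul h1
  simp only [D.apply_zero, sub_self, smul_zero, add_zero, plateauCut_zero D.eta_pos, one_smul] at h2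
  exact h2.const_add _

/-- **The Jacobian frame determinant of the adapted tube on the zero section** is
`det (γ, γ', conormal, normal)`. [folklore] -/
theorem tubeFrameDet_tube_zero (θ : ℝ) : tubeFrameDet D.tube (θ, 0) =
    frameDet (K.curve θ) (K.tangent θ) (D.conormal θ) (D.normal θ) := by
  obtain ⟨c₁, h₁⟩ := D.fderiv_tube_zero_snd θ (i := 0) (D.rawTube_single_zero θ)
    (by simp [D.apply_zero, plateauCut_zero D.eta_pos]) (D.hasDerivAt_rawTube_single_zero θ)
  obtain ⟨c₂, h₂⟩ := D.fderiv_tube_zero_snd θ (i := 1) (D.rawTube_single_one θ) (by simp)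
    (by simpa using ((hasDerivAt_id (0 : ℝ)).smul_const (D.normal θ)).const_add (K.curve θ))
  rw [tubeFrameDet_def, fderiv_tube_zero_fst, h₁, h₂, tube_zero, frameDet_add_smul]

/-- **The adapted tube is a local diffeomorphism along the zero section**: its Jacobian frame
determinant is positive there. [folklore] -/
theorem tubeFrameDet_tube_zero_pos (θ : ℝ) : 0 < tubeFrameDet D.tube (θ, 0) := by
  rw [tubeFrameDet_tube_zero]
  exact D.frameDet_curve_tangent_conormal_normal_pos θ

/-! #### A tube of positive Jacobian, the squeezed tube -/

/-- **A tube of positive Jacobian** (continuity, compactness of `[0, 2π] × {0}`, periodicity;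
Hirsch (1976), §4.5 Thm. 5.1). [folklore] -/
theorem exists_tubeFrameDet_tube_pos :
    ∃ ε : ℝ, 0 < ε ∧ ∀ θ : ℝ, ∀ w : 𝔼 2, ‖w‖ < ε → 0 < tubeFrameDet D.tube (θ, w) := by
  set S : Set (ℝ × 𝔼 2) := {q | 0 < tubeFrameDet D.tube q} with hSdef
  have hS : IsOpen S :=
    isOpen_lt continuous_const (continuous_tubeFrameDet (D.contDiff_tube.of_le (by simp)))
  have hsub : Icc 0 (2 * Real.pi) ×ˢ ({0} : Set (𝔼 2)) ⊆ S := by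
    rintro ⟨θ, w⟩ ⟨-, hw⟩
    rw [mem_singleton_iff] at hw
    subst hw
    exact D.tubeFrameDet_tube_zero_pos θ
  obtain ⟨U, V, -, hV, hIU, h0V, hUV⟩ :=
    generalized_tube_lemma isCompact_Icc isCompact_singleton hS hsub
  obtain ⟨ε, hε, hball⟩ := Metric.isOpen_iff.1 hV 0 (h0V rfl)
  refine ⟨ε, hε, fun θ w hw ↦ ?_⟩
  have hper : Periodic (fun t ↦ tubeFrameDet D.tube (t, w)) (2 * Real.pi) := fun t ↦
    tubeFrameDet_add_two_pi D.tube_add_two_pi t w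
  obtain ⟨θ', hθ', heq⟩ := hper.exists_mem_Ico₀ Real.two_pi_pos θ
  have hmem : (θ', w) ∈ S := hUV ⟨hIU (Ico_subset_Icc_self hθ'), hball (by simpa using hw)⟩
  rw [heq]
  exact hmem

/-- **A radius of positive Jacobian** for the adapted tube. [folklore] -/
def jacobiRadius : ℝ := Classical.choose D.exists_tubeFrameDet_tube_pos

/-- The radius of positive Jacobian is positive. [folklore] -/
theorem jacobiRadius_pos : 0 < D.jacobiRadius := (Classical.choose_spec D.exists_tubeFrameDet_tube_pos).1

/-- Within the radius of positive Jacobian the adapted tube has positive frame determinant.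
[folklore] -/
theorem tubeFrameDet_tube_pos {θ : ℝ} {w : 𝔼 2} (hw : ‖w‖ < D.jacobiRadius) :
    0 < tubeFrameDet D.tube (θ, w) :=
  (Classical.choose_spec D.exists_tubeFrameDet_tube_pos).2 θ w hw

/-- The differential of the (unsqueezed) tube is injective on the zero section. [folklore] -/
theorem fderiv_tube_zero_injective (θ : ℝ) : Injective (fderiv ℝ D.tube (θ, 0)) :=
  fderiv_injective_of_tubeFrameDet_ne_zero (D.tubeFrameDet_tube_zero_pos θ).ne'

/-- **The squeezed adapted tube** `G_δ (θ, w) = f (θ, σ_δ w)`. [folklore] -/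
def tubeδ (δ : ℝ) (q : ℝ × 𝔼 2) : 𝔼 4 := D.tube (q.1, squeeze δ q.2)

/-- Unfolding of `tubeδ`. [folklore] -/
theorem tubeδ_apply (δ θ : ℝ) (w : 𝔼 2) : D.tubeδ δ (θ, w) = D.tube (θ, squeeze δ w) := rfl

/-- The squeezed tube takes values in the unit sphere. [folklore] -/
@[simp] theorem norm_tubeδ (δ : ℝ) (q : ℝ × 𝔼 2) : ‖D.tubeδ δ q‖ = 1 := D.norm_tube _

/-- The squeezed tube is smooth. [folklore] -/
theorem contDiff_tubeδ (δ : ℝ) : ContDiff ℝ ∞ (D.tubeδ δ) :=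
  D.contDiff_tube.comp (contDiff_fst.prodMk ((contDiff_squeeze δ).comp contDiff_snd))

/-- The squeezed tube is differentiable. [folklore] -/
theorem differentiable_tubeδ (δ : ℝ) : Differentiable ℝ (D.tubeδ δ) :=
  (D.contDiff_tubeδ δ).differentiable (by simp)

/-- On the zero section the squeezed tube is the knot. [folklore] -/
@[simp] theorem tubeδ_zero (δ θ : ℝ) : D.tubeδ δ (θ, 0) = K.curve θ := by
  rw [tubeδ_apply, squeeze_zero, tube_zero]

/-- The squeezed tube is `2π`-periodic in `θ`. [folklore] -/
theorem tubeδ_add_two_pi (δ θ : ℝ) (w : 𝔼 2) : D.tubeδ δ (θ + 2 * Real.pi, w) = D.tubeδ δ (θ, w) := by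
  rw [tubeδ_apply, tubeδ_apply, tube_add_two_pi]

/-- Chain rule for the squeezed tube. [folklore] -/
theorem hasFDerivAt_tubeδ (δ θ : ℝ) (w : 𝔼 2) :
    HasFDerivAt (D.tubeδ δ) ((fderiv ℝ D.tube (θ, squeeze δ w)).comp
      ((ContinuousLinearMap.fst ℝ ℝ (𝔼 2)).prod
        ((squeezeFDeriv δ w).comp (ContinuousLinearMap.snd ℝ ℝ (𝔼 2))))) (θ, w) := by
  have h2 : HasFDerivAt (squeeze δ ∘ Prod.snd)
      ((squeezeFDeriv δ w).comp (ContinuousLinearMap.snd ℝ ℝ (𝔼 2))) (θ, w) :=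
    (hasFDerivAt_squeeze δ w).comp (θ, w) hasFDerivAt_snd
  have h1 := (hasFDerivAt_fst (p := (θ, w))).prodMk h2
  have h3 : HasFDerivAt D.tube (fderiv ℝ D.tube (θ, squeeze δ w)) (θ, squeeze δ w) :=
    (D.differentiable_tube _).hasFDerivAt
  exact h3.comp (θ, w) h1

/-- Jacobian frame determinant of the squeezed tube:
`det (G_δ, ∂G_δ) (θ, w) = det (Dσ_δ w) · det (f, ∂f) (θ, σ_δ w)`. [folklore] -/
theorem tubeFrameDet_tubeδ (δ θ : ℝ) (w : 𝔼 2) :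
    tubeFrameDet (D.tubeδ δ) (θ, w) =
      (squeezeMatrix δ w 0 0 * squeezeMatrix δ w 1 1 - squeezeMatrix δ w 0 1 * squeezeMatrix δ w 1 0)
        * tubeFrameDet D.tube (θ, squeeze δ w) := by
  rw [tubeFrameDet_def, tubeFrameDet_def, (D.hasFDerivAt_tubeδ δ θ w).fderiv, tubeδ_apply]
  simp only [ContinuousLinearMap.comp_apply, ContinuousLinearMap.prod_apply,
    ContinuousLinearMap.coe_fst', ContinuousLinearMap.coe_snd', map_zero, squeezeFDeriv_single_eq]
  set L := fderiv ℝ D.tube (θ, squeeze δ w)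
  have hlin : ∀ a b : ℝ, L (0, a • EuclideanSpace.single 0 (1 : ℝ) + b • EuclideanSpace.single 1 (1 : ℝ))
      = a • L (0, EuclideanSpace.single 0 1) + b • L (0, EuclideanSpace.single 1 1) := by
    intro a b
    rw [← map_smul, ← map_smul, ← map_add]
    congr 1
    ext <;> simp
  rw [hlin, hlin, frameDet_comb₂]

/-- The squeezed tube has positive Jacobian everywhere (`0 < δ ≤ jacobiRadius`). [folklore] -/
theorem tubeFrameDet_tubeδ_pos {δ : ℝ} (hδ : 0 < δ) (hδr : δ ≤ D.jacobiRadius) (q : ℝ × 𝔼 2) :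
    0 < tubeFrameDet (D.tubeδ δ) q := by
  obtain ⟨θ, w⟩ := q
  rw [tubeFrameDet_tubeδ]
  exact mul_pos (squeezeMatrix_det_pos hδ w)
    (D.tubeFrameDet_tube_pos ((norm_squeeze_lt hδ w).trans_le hδr))

/-- The differential of the squeezed tube is injective everywhere (`0 < δ ≤ jacobiRadius`).
[folklore] -/
theorem fderiv_tubeδ_injective {δ : ℝ} (hδ : 0 < δ) (hδr : δ ≤ D.jacobiRadius) (q : ℝ × 𝔼 2) :
    Injective (fderiv ℝ (D.tubeδ δ) q) :=
  fderiv_injective_of_tubeFrameDet_ne_zero (D.tubeFrameDet_tubeδ_pos hδ hδr q).ne'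

/-- Orientation of the squeezed tube in the form of `Knot.TubularNbhd.det_pos`. [folklore] -/
theorem det_deriv_tubeδ_pos {δ : ℝ} (hδ : 0 < δ) (hδr : δ ≤ D.jacobiRadius) (θ : ℝ) (w : 𝔼 2) :
    0 < Matrix.det (Matrix.of
      ![⇑(D.tubeδ δ (θ, w)),
        ⇑(deriv (fun t : ℝ ↦ D.tubeδ δ (t, w)) θ),
        ⇑(deriv (fun s : ℝ ↦ D.tubeδ δ (θ, w + EuclideanSpace.single 0 s)) 0),
        ⇑(deriv (fun s : ℝ ↦ D.tubeδ δ (θ, w + EuclideanSpace.single 1 s)) 0)]) := by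
  rw [← tubeFrameDet_eq_det_deriv (D.differentiable_tubeδ δ)]
  exact D.tubeFrameDet_tubeδ_pos hδ hδr (θ, w)

end CollarSheet

end SphereEmbedding

/-! ### The adapted tubular neighbourhood on the manifold `𝕊¹ × ℝ²` -/

/-- Local notation: the model with corners of `S¹ × ℝ²`. -/
local notation "𝓘₁₂" => (ModelWithCorners.prod (𝓡 1) 𝓘(ℝ, EuclideanSpace ℝ (Fin 2)))

namespace SphereEmbedding.CollarSheet

variable {K : SphereEmbedding 1 3} (D : CollarSheet K)

/-- The **pre-tubular map** of the adapted tube: `tube` lifted to `𝕊¹ × ℝ²`. [folklore] -/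
def preTubularMap : (𝕊 1) × 𝔼 2 → 𝕊 3 := periodicLift D.tube D.norm_tube

/-- The pre-tubular map over an angle. [folklore] -/
theorem coe_preTubularMap_circlePoint (t : ℝ) (w : 𝔼 2) :
    (D.preTubularMap (circlePoint t, w) : 𝔼 4) = D.tube (t, w) :=
  coe_periodicLift_circlePoint D.tube_add_two_pi D.norm_tube t w

/-- On the zero section the pre-tubular map is the knot. [folklore] -/
@[simp] theorem preTubularMap_zero (u : 𝕊 1) : D.preTubularMap (u, 0) = K u := by
  obtain ⟨t, rfl⟩ := circlePoint_surjective u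
  apply Subtype.ext
  rw [coe_preTubularMap_circlePoint, tube_zero, curve_apply]

/-- The pre-tubular map is continuous. [folklore] -/
theorem continuous_preTubularMap : Continuous D.preTubularMap :=
  continuous_periodicLift D.contDiff_tube D.tube_add_two_pi D.norm_tube

/-- The pre-tubular map is a local diffeomorphism at the points of the zero section. [folklore] -/
theorem isLocalDiffeomorphAt_preTubularMap_zero (u : 𝕊 1) :
    IsLocalDiffeomorphAt 𝓘₁₂ (𝓡 3) ∞ D.preTubularMap (u, 0) :=
  isLocalDiffeomorphAt_periodicLift D.contDiff_tube D.tube_add_two_pi D.norm_tube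
    fun t _ ↦ D.fderiv_tube_zero_injective t

/-- **An injectivity radius** (Hirsch (1976), §4.5, proof of Thm. 5.1 via §2.1 Ex. 7): the
pre-tubular map is injective on `𝕊¹ × B (0, r)` for some `r > 0` — a local diffeomorphism injective
on the compact zero section (`K` is injective) is injective near it. [cite: Hirsch1976, §4.5 Thm 5.1] -/
theorem exists_injOn_preTubularMap :
    ∃ r : ℝ, 0 < r ∧ InjOn D.preTubularMap (univ ×ˢ Metric.ball (0 : 𝔼 2) r) := by
  set f := D.preTubularMap with hfdef
  have hfc : Continuous f := D.continuous_preTubularMap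
  have hloc : ∀ u : 𝕊 1, ∃ U : Set ((𝕊 1) × 𝔼 2), IsOpen U ∧ (u, (0 : 𝔼 2)) ∈ U ∧ InjOn f U :=
    fun u ↦ exists_isOpen_injOn_of_isLocalDiffeomorphAt (D.isLocalDiffeomorphAt_preTubularMap_zero u)
  choose U hUo hUmem hUinj using hloc
  set W : Set (((𝕊 1) × 𝔼 2) × ((𝕊 1) × 𝔼 2)) := ⋃ u, U u ×ˢ U u with hWdef
  have hW : IsOpen W := isOpen_iUnion fun u ↦ (hUo u).prod (hUo u)
  set C : Set ((𝕊 1) × 𝔼 2) := univ ×ˢ Metric.closedBall (0 : 𝔼 2) 1 with hCdef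
  have hC : IsCompact C := isCompact_univ.prod (isCompact_closedBall 0 1)
  set Z : Set (((𝕊 1) × 𝔼 2) × ((𝕊 1) × 𝔼 2)) := {pq | f pq.1 = f pq.2} ∩ C ×ˢ C with hZdef
  have hZ : IsCompact Z :=
    (hC.prod hC).inter_left (isClosed_eq (hfc.comp continuous_fst) (hfc.comp continuous_snd))
  have hZ₀ : IsCompact (Z \ W) := hZ.diff hW
  set g : ((𝕊 1) × 𝔼 2) × ((𝕊 1) × 𝔼 2) → ℝ := fun pq ↦ ‖pq.1.2‖ + ‖pq.2.2‖ with hgdef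
  have hg : Continuous g := by fun_prop
  have hgpos : ∀ pq ∈ Z \ W, 0 < g pq := by
    rintro ⟨⟨u, w⟩, ⟨u', w'⟩⟩ ⟨⟨hpq, -⟩, hnotW⟩
    refine lt_of_le_of_ne (by positivity) fun h0 ↦ hnotW ?_
    simp only [hgdef] at h0
    have hw : w = 0 := norm_eq_zero.1 (by linarith [norm_nonneg w, norm_nonneg w'])
    have hw' : w' = 0 := norm_eq_zero.1 (by linarith [norm_nonneg w, norm_nonneg w'])
    subst hw hw'
    have hK : K u = K u' := by
      rw [← D.preTubularMap_zero, ← D.preTubularMap_zero]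
      exact hpq
    obtain rfl : u = u' := K.injective hK
    exact mem_iUnion.2 ⟨u, hUmem u, hUmem u⟩
  obtain ⟨δ₀, hδ₀, hδ₀le⟩ : ∃ δ₀ : ℝ, 0 < δ₀ ∧ ∀ pq ∈ Z \ W, δ₀ ≤ g pq := by
    rcases (Z \ W).eq_empty_or_nonempty with h | h
    · exact ⟨1, one_pos, fun pq hpq ↦ by rw [h] at hpq; exact absurd hpq (notMem_empty _)⟩
    · obtain ⟨pq₀, hpq₀, hmin⟩ := hZ₀.exists_isMinOn h hg.continuousOn
      exact ⟨g pq₀, hgpos pq₀ hpq₀, fun pq hpq ↦ hmin hpq⟩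
  refine ⟨min (δ₀ / 2) 1, by positivity, ?_⟩
  rintro p ⟨-, hp⟩ q ⟨-, hq⟩ hpq
  rw [Metric.mem_ball, dist_zero_right, lt_min_iff] at hp hq
  by_contra hne
  have hpC : p ∈ C := ⟨mem_univ _, Metric.mem_closedBall.2 (by rw [dist_zero_right]; exact hp.2.le)⟩
  have hqC : q ∈ C := ⟨mem_univ _, Metric.mem_closedBall.2 (by rw [dist_zero_right]; exact hq.2.le)⟩
  have hmem : (p, q) ∈ Z \ W := by
    refine ⟨⟨hpq, hpC, hqC⟩, fun hWmem ↦ hne ?_⟩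
    obtain ⟨u, hu⟩ := mem_iUnion.1 hWmem
    exact hUinj u hu.1 hu.2 hpq
  have := hδ₀le _ hmem
  simp only [hgdef] at this
  linarith [hp.1, hq.1]

/-- An injectivity radius of the pre-tubular map. [folklore] -/
def injRadius : ℝ := Classical.choose D.exists_injOn_preTubularMap

/-- The injectivity radius is positive. [folklore] -/
theorem injRadius_pos : 0 < D.injRadius := (Classical.choose_spec D.exists_injOn_preTubularMap).1

/-- The pre-tubular map is injective on `𝕊¹ × B (0, injRadius)`. [folklore] -/
theorem injOn_preTubularMap : InjOn D.preTubularMap (univ ×ˢ Metric.ball (0 : 𝔼 2) D.injRadius) :=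
  (Classical.choose_spec D.exists_injOn_preTubularMap).2

/-- **The radius of the adapted tubular neighbourhood**: the smallest of the radius of positive
Jacobian, the injectivity radius and half the closeness height `η/2` (so that the squeezed
`w₀`-axis stays where the tube is the sheet). [folklore] -/
def tubularRadius : ℝ := min (min D.jacobiRadius D.injRadius) (D.eta / 2)

/-- The tubular radius is positive. [folklore] -/
theorem tubularRadius_pos : 0 < D.tubularRadius :=
  lt_min (lt_min D.jacobiRadius_pos D.injRadius_pos) (by linarith [D.eta_pos])

/-- The tubular radius is at most the radius of positive Jacobian. [folklore] -/
theorem tubularRadius_le_jacobiRadius : D.tubularRadius ≤ D.jacobiRadius :=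
  (min_le_left _ _).trans (min_le_left _ _)

/-- The tubular radius is at most the injectivity radius. [folklore] -/
theorem tubularRadius_le_injRadius : D.tubularRadius ≤ D.injRadius :=
  (min_le_left _ _).trans (min_le_right _ _)

/-- The tubular radius is at most `η/2`. [folklore] -/
theorem tubularRadius_le_half_eta : D.tubularRadius ≤ D.eta / 2 := min_le_right _ _

/-- **The adapted tubular map** `ν : 𝕊¹ × ℝ² → 𝕊³`: the squeezed tube lifted to the manifold.
[folklore] -/
def tubularMap : (𝕊 1) × 𝔼 2 → 𝕊 3 :=
  periodicLift (D.tubeδ D.tubularRadius) (D.norm_tubeδ D.tubularRadius)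

/-- The tubular map is the pre-tubular map after squeezing the fibre. [folklore] -/
theorem tubularMap_apply (p : (𝕊 1) × 𝔼 2) :
    D.tubularMap p = D.preTubularMap (p.1, squeeze D.tubularRadius p.2) :=
  Subtype.ext rfl

/-- The tubular map over an angle. [folklore] -/
theorem coe_tubularMap_circlePoint (t : ℝ) (w : 𝔼 2) :
    (D.tubularMap (circlePoint t, w) : 𝔼 4) = D.tubeδ D.tubularRadius (t, w) :=
  coe_periodicLift_circlePoint (D.tubeδ_add_two_pi D.tubularRadius) (D.norm_tubeδ D.tubularRadius) t w

/-- **The tubular map extends the knot**: `ν (u, 0) = K u`. [folklore] -/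
@[simp] theorem tubularMap_zero (u : 𝕊 1) : D.tubularMap (u, 0) = K u := by
  rw [tubularMap_apply, squeeze_zero, preTubularMap_zero]

/-- The tubular map is smooth. [folklore] -/
theorem contMDiff_tubularMap : ContMDiff 𝓘₁₂ (𝓡 3) ∞ D.tubularMap :=
  contMDiff_periodicLift (D.contDiff_tubeδ _) (D.tubeδ_add_two_pi _) (D.norm_tubeδ _)

/-- **The tubular map is injective.** [folklore] -/
theorem tubularMap_injective : Injective D.tubularMap := by
  intro p q h
  have hball : ∀ w : 𝔼 2, squeeze D.tubularRadius w ∈ Metric.ball (0 : 𝔼 2) D.injRadius :=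
    fun w ↦ by
    rw [Metric.mem_ball, dist_zero_right]
    exact (norm_squeeze_lt D.tubularRadius_pos w).trans_le D.tubularRadius_le_injRadius
  have hp : (p.1, squeeze D.tubularRadius p.2) ∈ univ ×ˢ Metric.ball (0 : 𝔼 2) D.injRadius :=
    Set.mk_mem_prod (mem_univ _) (hball p.2)
  have hq : (q.1, squeeze D.tubularRadius q.2) ∈ univ ×ˢ Metric.ball (0 : 𝔼 2) D.injRadius :=
    Set.mk_mem_prod (mem_univ _) (hball q.2)
  have h2 : D.preTubularMap (p.1, squeeze D.tubularRadius p.2) =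
      D.preTubularMap (q.1, squeeze D.tubularRadius q.2) := by
    rw [← tubularMap_apply, ← tubularMap_apply]
    exact h
  have h' : (p.1, squeeze D.tubularRadius p.2) = (q.1, squeeze D.tubularRadius q.2) :=
    D.injOn_preTubularMap hp hq h2
  obtain ⟨h1, h3⟩ := Prod.mk_inj.1 h'
  exact Prod.ext h1 (squeeze_injective D.tubularRadius_pos h3)

/-- **The tubular map is a local diffeomorphism everywhere.** [folklore] -/
theorem isLocalDiffeomorph_tubularMap : IsLocalDiffeomorph 𝓘₁₂ (𝓡 3) ∞ D.tubularMap := fun p ↦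
  isLocalDiffeomorphAt_periodicLift (D.contDiff_tubeδ _) (D.tubeδ_add_two_pi _) (D.norm_tubeδ _)
    fun t _ ↦ D.fderiv_tubeδ_injective D.tubularRadius_pos D.tubularRadius_le_jacobiRadius (t, p.2)

/-- The tubular map is an immersion. [folklore] -/
theorem isImmersion_tubularMap : Manifold.IsImmersion 𝓘₁₂ (𝓡 3) ∞ D.tubularMap :=
  Manifold.IsImmersionOfComplement.isImmersion (F := Unit) fun p ↦
    isImmersionAtOfComplement_periodicLift (D.contDiff_tubeδ _) (D.tubeδ_add_two_pi _) (D.norm_tubeδ _)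
      fun t _ ↦ D.fderiv_tubeδ_injective D.tubularRadius_pos D.tubularRadius_le_jacobiRadius (t, p.2)

/-- The tubular map is an open embedding. [folklore] -/
theorem isOpenEmbedding_tubularMap : _root_.Topology.IsOpenEmbedding D.tubularMap :=
  D.isLocalDiffeomorph_tubularMap.isLocalHomeomorph.isOpenEmbedding_of_injective D.tubularMap_injective

/-- The tubular map is a smooth embedding. [folklore] -/
theorem isSmoothEmbedding_tubularMap : Manifold.IsSmoothEmbedding 𝓘₁₂ (𝓡 3) ∞ D.tubularMap :=
  ⟨D.isImmersion_tubularMap, D.isOpenEmbedding_tubularMap.isEmbedding⟩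

/-- The tubular map is positively oriented. [folklore] -/
theorem det_pos_tubularMap (θ : ℝ) (w : 𝔼 2) :
    0 < Matrix.det (Matrix.of
      ![⇑(D.tubularMap (circlePoint θ, w) : 𝔼 4),
        ⇑(deriv (fun t : ℝ ↦ (D.tubularMap (circlePoint t, w) : 𝔼 4)) θ),
        ⇑(deriv (fun s : ℝ ↦ (D.tubularMap (circlePoint θ, w + EuclideanSpace.single 0 s) : 𝔼 4)) 0),
        ⇑(deriv (fun s : ℝ ↦ (D.tubularMap (circlePoint θ, w + EuclideanSpace.single 1 s) : 𝔼 4)) 0)]) := by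
  simp only [coe_tubularMap_circlePoint]
  exact D.det_deriv_tubeδ_pos D.tubularRadius_pos D.tubularRadius_le_jacobiRadius θ w

/-- **The tubular neighbourhood of `K` adapted to the collar sheet** (Hirsch (1976), §4.5,
Thms. 5.1–5.2, with the sheet as the first fibre direction). [cite: Hirsch1976, §4.5 Thm 5.2] -/
def tubularNbhd : Knot.TubularNbhd K where
  toFun := D.tubularMap
  isSmoothEmbedding := D.isSmoothEmbedding_tubularMap
  apply_zero := D.tubularMap_zero
  det_pos := D.det_pos_tubularMap

/-- The adapted tubular neighbourhood is the tubular map. [folklore] -/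
@[simp] theorem tubularNbhd_apply (p : (𝕊 1) × 𝔼 2) : D.tubularNbhd p = D.tubularMap p := rfl

/-! #### The adapted tube is the sheet on the positive `w₀`-axis -/

/-- **The height profile** `ρ (x) = δ x / √(1 + x²)` of the squeezed `w₀`-axis
(`δ = tubularRadius`): `σ_δ (x e₀) = ρ (x) e₀`. [folklore] -/
def heightOf (x : ℝ) : ℝ := D.tubularRadius * (√(1 + x ^ 2))⁻¹ * x

/-- Unfolding of `heightOf`. [folklore] -/
theorem heightOf_def (x : ℝ) : D.heightOf x = D.tubularRadius * (√(1 + x ^ 2))⁻¹ * x := rfl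

/-- The squeeze of a point of the `w₀`-axis. [folklore] -/
theorem squeeze_single_zero (x : ℝ) :
    squeeze D.tubularRadius (EuclideanSpace.single 0 x) = EuclideanSpace.single 0 (D.heightOf x) := by
  rw [squeeze_def, squeezeFactor_def, PiLp.norm_single, Real.norm_eq_abs, sq_abs, heightOf_def,
    euclideanSpace_single_eq_smul 0 x, smul_smul, euclideanSpace_single_eq_smul 0 (_ * x)]

/-- `ρ 0 = 0`. [folklore] -/
@[simp] theorem heightOf_zero : D.heightOf 0 = 0 := by simp [heightOf_def]

/-- `ρ` is non-negative on `[0, ∞)`. [folklore] -/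
theorem heightOf_nonneg {x : ℝ} (hx : 0 ≤ x) : 0 ≤ D.heightOf x :=
  mul_nonneg (mul_nonneg D.tubularRadius_pos.le (inv_nonneg.2 (Real.sqrt_nonneg _))) hx

/-- `|ρ (x)| < δ`. [folklore] -/
theorem abs_heightOf_lt (x : ℝ) : |D.heightOf x| < D.tubularRadius := by
  have h := norm_squeeze_lt D.tubularRadius_pos (EuclideanSpace.single (0 : Fin 2) x)
  rwa [squeeze_single_zero, PiLp.norm_single, Real.norm_eq_abs] at h

/-- `ρ (x) ≤ η/2` for `x ≥ 0`. [folklore] -/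
theorem heightOf_le_half_eta (x : ℝ) : D.heightOf x ≤ D.eta / 2 :=
  ((le_abs_self _).trans (D.abs_heightOf_lt x).le).trans D.tubularRadius_le_half_eta

/-- `ρ` is continuous. [folklore] -/
theorem continuous_heightOf : Continuous D.heightOf := by
  unfold heightOf
  refine (continuous_const.mul ((Real.continuous_sqrt.comp (by fun_prop)).inv₀ fun x ↦ ?_)).mul
    continuous_id
  exact (Real.sqrt_pos.2 (by positivity)).ne'

/-- `ρ` is strictly monotone on `[0, ∞)`: `ρ (x) = δ · (x / √(1 + x²))`. [folklore] -/
theorem strictMonoOn_heightOf : StrictMonoOn D.heightOf (Ici 0) := by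
  have key : StrictMonoOn (fun x : ℝ ↦ x / √(1 + x ^ 2)) (Ici 0) := by
    intro x (h0x : 0 ≤ x) y _ hxy
    have hx : 0 < √(1 + x ^ 2) := Real.sqrt_pos.2 (by positivity)
    have hy : 0 < √(1 + y ^ 2) := Real.sqrt_pos.2 (by positivity)
    rw [div_lt_div_iff₀ hx hy]
    have h0y : 0 < y := h0x.trans_lt hxy
    by_contra hcon
    push Not at hcon
    have h2 : 0 ≤ y * √(1 + x ^ 2) := by positivity
    have hsq := mul_self_le_mul_self h2 hcon
    have e1 : (y * √(1 + x ^ 2)) * (y * √(1 + x ^ 2)) = y ^ 2 * (1 + x ^ 2) := by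
      rw [mul_mul_mul_comm, Real.mul_self_sqrt (by positivity)]; ring
    have e2 : (x * √(1 + y ^ 2)) * (x * √(1 + y ^ 2)) = x ^ 2 * (1 + y ^ 2) := by
      rw [mul_mul_mul_comm, Real.mul_self_sqrt (by positivity)]; ring
    rw [e1, e2] at hsq
    nlinarith [mul_pos h0y h0y, sq_nonneg x, mul_self_lt_mul_self h0x hxy]
  intro x hx y hy hxy
  have h := key hx hy hxy
  simp only [heightOf_def]
  have e1 : D.tubularRadius * (√(1 + x ^ 2))⁻¹ * x = D.tubularRadius * (x / √(1 + x ^ 2)) := by ring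
  have e2 : D.tubularRadius * (√(1 + y ^ 2))⁻¹ * y = D.tubularRadius * (y / √(1 + y ^ 2)) := by ring
  rw [e1, e2]
  exact mul_lt_mul_of_pos_left h D.tubularRadius_pos

/-- `ρ` is injective on `[0, ∞)`. [folklore] -/
theorem injOn_heightOf : InjOn D.heightOf (Ici 0) := D.strictMonoOn_heightOf.injOn

/-- **The adapted tube is the sheet on the positive `w₀`-axis**:
`ν (e^{iθ}, x e₀) = A (ρ (x), θ)` for `x ≥ 0`. [folklore] -/
theorem tubularNbhd_circlePoint_single_zero {x : ℝ} (hx : 0 ≤ x) (θ : ℝ) :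
    ((D.tubularNbhd (circlePoint θ, EuclideanSpace.single 0 x) : 𝕊 3) : 𝔼 4) = D.A (D.heightOf x, θ) := by
  rw [tubularNbhd_apply, coe_tubularMap_circlePoint, tubeδ_apply, squeeze_single_zero,
    D.tube_single_zero (D.heightOf_nonneg hx) (D.heightOf_le_half_eta x)]

end SphereEmbedding.CollarSheet


namespace Knot

/-! ### The knot in `ℝ⁴` is a smooth embedding of the circle -/

/-- The knot followed by `𝕊³ ⊆ ℝ⁴` is a smooth embedding `𝕊¹ ↪ ℝ⁴` (an injective immersion of a
compact manifold). [folklore] -/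
theorem isSmoothEmbedding_coe_comp (K : Knot) :
    Manifold.IsSmoothEmbedding (𝓡 1) 𝓘(ℝ, 𝔼 4) ∞ (fun u : 𝕊 1 ↦ ((K u : 𝕊 3) : 𝔼 4)) :=
  isSmoothEmbedding_of_injective_of_injective_mfderiv K.contMDiff_coe_comp (by simp)
    (Subtype.val_injective.comp K.injective) K.mfderiv_coe_comp_injective

namespace IsSpanningSurfaceOfGenus

variable {K : Knot} {S : Type} [TopologicalSpace S] [ChartedSpace (EuclideanHalfSpace 2) S]
  [IsManifold (𝓡∂ 2) ∞ S] {F : S → 𝔼 4} {e : ↥((𝓡∂ 2).boundary S) ≃ₜ ↥(𝕊 1)} {g : ℕ}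

/-! ### The boundary identification of a Seifert surface is a diffeomorphism -/

/-- Along the boundary, a spanning surface is the knot through the boundary identification:
`(K ∘ e) = F ∘ Subtype.val` in `ℝ⁴`. [folklore] -/
theorem coe_comp_boundary_eq (hF : K.IsSpanningSurfaceOfGenus F e g) :
    (fun z : (𝓡∂ 2).boundary S ↦ ((K (e z) : 𝕊 3) : 𝔼 4)) = F ∘ Subtype.val :=
  funext fun z ↦ (hF.2.2.2.2.1 z).symm

/-- A spanning surface restricted to the boundary is smooth (as a map of the boundary
`1`-manifold). [folklore] -/
theorem contMDiff_comp_subtype_val (hF : K.IsSpanningSurfaceOfGenus F e g) :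
    ContMDiff (𝓡 1) 𝓘(ℝ, 𝔼 4) ∞ (F ∘ (Subtype.val : (𝓡∂ 2).boundary S → S)) :=
  hF.2.1.comp BoundaryManifold.isSmoothEmbedding_subtype_val.contMDiff

/-- **The boundary identification `e : ∂S ≃ₜ 𝕊¹` of a Seifert surface is smooth**: `K ∘ e` is the
smooth map `F|∂S` and `K` is a smooth embedding into `ℝ⁴`. [folklore] -/
theorem contMDiff_boundaryHomeomorph (hF : K.IsSpanningSurfaceOfGenus F e g) :
    ContMDiff (𝓡 1) (𝓡 1) ∞ e := by
  refine contMDiff_of_comp_isSmoothEmbedding K.isSmoothEmbedding_coe_comp ?_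
  show ContMDiff (𝓡 1) 𝓘(ℝ, 𝔼 4) ∞ fun z : (𝓡∂ 2).boundary S ↦ ((K (e z) : 𝕊 3) : 𝔼 4)
  rw [hF.coe_comp_boundary_eq]
  exact hF.contMDiff_comp_subtype_val

/-- The differential of `F|∂S` is injective (`F` and `∂S ↪ S` are immersions). [folklore] -/
theorem mfderiv_comp_subtype_val_injective (hF : K.IsSpanningSurfaceOfGenus F e g)
    (z : (𝓡∂ 2).boundary S) :
    Injective (mfderiv (𝓡 1) 𝓘(ℝ, 𝔼 4) (F ∘ (Subtype.val : (𝓡∂ 2).boundary S → S)) z) := by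
  have hn : (∞ : WithTop ℕ∞) ≠ 0 := by simp
  rw [mfderiv_comp z ((hF.2.1 z.val).mdifferentiableAt hn)
    ((BoundaryManifold.isSmoothEmbedding_subtype_val.contMDiff z).mdifferentiableAt hn)]
  exact (hF.2.2.2.1 z.val).comp (mfderiv_injective_of_isImmersion
    BoundaryManifold.isImmersion_subtype_val (by simp) z)

/-- The differential of the boundary identification is injective. [folklore] -/
theorem mfderiv_boundaryHomeomorph_injective (hF : K.IsSpanningSurfaceOfGenus F e g)
    (z : (𝓡∂ 2).boundary S) : Injective (mfderiv (𝓡 1) (𝓡 1) e z) := by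
  refine SchoenfliesTools.injective_mfderiv_of_comp_isSmoothEmbedding K.isSmoothEmbedding_coe_comp
    ?_ ?_
  · show ContMDiff (𝓡 1) 𝓘(ℝ, 𝔼 4) ∞ fun z : (𝓡∂ 2).boundary S ↦ ((K (e z) : 𝕊 3) : 𝔼 4)
    rw [hF.coe_comp_boundary_eq]
    exact hF.contMDiff_comp_subtype_val
  · show Injective (mfderiv (𝓡 1) 𝓘(ℝ, 𝔼 4) (fun z : (𝓡∂ 2).boundary S ↦ ((K (e z) : 𝕊 3) : 𝔼 4)) z)
    rw [hF.coe_comp_boundary_eq]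
    exact hF.mfderiv_comp_subtype_val_injective z

/-- The boundary identification is a local diffeomorphism (injective differential between
`1`-manifolds, inverse function theorem). [folklore] -/
theorem isLocalDiffeomorph_boundaryHomeomorph (hF : K.IsSpanningSurfaceOfGenus F e g) :
    IsLocalDiffeomorph (𝓡 1) (𝓡 1) ∞ e := fun z ↦ by
  set L₀ : EuclideanSpace ℝ (Fin 1) →L[ℝ] EuclideanSpace ℝ (Fin 1) := mfderiv (𝓡 1) (𝓡 1) e z
    with hL₀
  have hinj : Injective L₀ := hF.mfderiv_boundaryHomeomorph_injective z
  have hsurj : Surjective L₀ :=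
    (LinearMap.injective_iff_surjective_of_finrank_eq_finrank
      (f := (L₀ : EuclideanSpace ℝ (Fin 1) →ₗ[ℝ] EuclideanSpace ℝ (Fin 1))) rfl).1 hinj
  set L : EuclideanSpace ℝ (Fin 1) ≃L[ℝ] EuclideanSpace ℝ (Fin 1) :=
    (LinearEquiv.ofBijective (L₀ : _ →ₗ[ℝ] _) ⟨hinj, hsurj⟩).toContinuousLinearEquiv with hL
  refine isLocalDiffeomorphAt_of_mfderiv isOpen_univ (mem_univ z)
    hF.contMDiff_boundaryHomeomorph.contMDiffOn (by norm_num) L ?_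
  ext v
  rfl

/-- **The boundary identification of a Seifert surface as a diffeomorphism** `∂S ≅ 𝕊¹`
(a bijective local diffeomorphism). [folklore] -/
def boundaryDiffeomorph (hF : K.IsSpanningSurfaceOfGenus F e g) :
    ↥((𝓡∂ 2).boundary S) ≃ₘ⟮𝓡 1, 𝓡 1⟯ ↥(𝕊 1) :=
  hF.isLocalDiffeomorph_boundaryHomeomorph.diffeomorphOfBijective e.bijective

/-- The boundary diffeomorphism is the boundary identification. [folklore] -/
@[simp] theorem coe_boundaryDiffeomorph (hF : K.IsSpanningSurfaceOfGenus F e g) :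
    ⇑hF.boundaryDiffeomorph = e := rfl

/-- The inverse of the boundary diffeomorphism is the inverse identification. [folklore] -/
@[simp] theorem boundaryDiffeomorph_symm_apply (hF : K.IsSpanningSurfaceOfGenus F e g) (u : 𝕊 1) :
    hF.boundaryDiffeomorph.symm u = e.symm u := by
  have h1 : hF.boundaryDiffeomorph (hF.boundaryDiffeomorph.symm u) = u :=
    Diffeomorph.apply_symm_apply _ _
  rw [coe_boundaryDiffeomorph] at h1
  rw [← e.symm_apply_apply (hF.boundaryDiffeomorph.symm u), h1]

/-! ### The boundary point over an angle -/

/-- **The boundary point of `S` over the angle `θ`**: `z (θ) = e⁻¹ (cos θ, sin θ)`. [folklore] -/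
def angleBd (hF : K.IsSpanningSurfaceOfGenus F e g) (θ : ℝ) : (𝓡∂ 2).boundary S :=
  hF.boundaryDiffeomorph.symm (circlePoint θ)

/-- `z (θ) = e⁻¹ (cos θ, sin θ)`. [folklore] -/
theorem angleBd_apply (hF : K.IsSpanningSurfaceOfGenus F e g) (θ : ℝ) :
    hF.angleBd θ = e.symm (circlePoint θ) :=
  hF.boundaryDiffeomorph_symm_apply _

/-- `e (z θ) = (cos θ, sin θ)`. [folklore] -/
@[simp] theorem apply_angleBd (hF : K.IsSpanningSurfaceOfGenus F e g) (θ : ℝ) :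
    e (hF.angleBd θ) = circlePoint θ := by
  rw [angleBd_apply, Homeomorph.apply_symm_apply]

/-- The boundary point over an angle depends smoothly on the angle. [folklore] -/
theorem contMDiff_angleBd (hF : K.IsSpanningSurfaceOfGenus F e g) :
    ContMDiff 𝓘(ℝ, ℝ) (𝓡 1) ∞ hF.angleBd :=
  hF.boundaryDiffeomorph.symm.contMDiff.comp contMDiff_circlePoint

/-- The boundary point over an angle is continuous in the angle. [folklore] -/
theorem continuous_angleBd (hF : K.IsSpanningSurfaceOfGenus F e g) : Continuous hF.angleBd :=
  hF.contMDiff_angleBd.continuous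

/-- The boundary point over an angle is `2π`-periodic. [folklore] -/
theorem periodic_angleBd (hF : K.IsSpanningSurfaceOfGenus F e g) : Periodic hF.angleBd (2 * Real.pi) :=
  fun θ ↦ by rw [angleBd, angleBd, circlePoint_add_two_pi]

/-- **The differential of `θ ↦ z (θ)` is injective** (`e⁻¹` is a diffeomorphism and the circle
parametrisation an immersion). [folklore] -/
theorem mfderiv_angleBd_injective (hF : K.IsSpanningSurfaceOfGenus F e g) (θ : ℝ) :
    Injective (mfderiv 𝓘(ℝ, ℝ) (𝓡 1) hF.angleBd θ) := by
  have hn : (∞ : WithTop ℕ∞) ≠ 0 := by simp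
  have h1 : MDifferentiableAt 𝓘(ℝ, ℝ) (𝓡 1) circlePoint θ :=
    (contMDiff_circlePoint θ).mdifferentiableAt hn
  have h2 : MDifferentiableAt (𝓡 1) (𝓡 1) hF.boundaryDiffeomorph.symm (circlePoint θ) :=
    (hF.boundaryDiffeomorph.symm.contMDiff _).mdifferentiableAt hn
  rw [show hF.angleBd = hF.boundaryDiffeomorph.symm ∘ circlePoint from rfl, mfderiv_comp θ h2 h1]
  have hi2 : Injective (mfderiv (𝓡 1) (𝓡 1) hF.boundaryDiffeomorph.symm (circlePoint θ)) :=
    (hF.boundaryDiffeomorph.symm.mfderivToContinuousLinearEquiv hn (circlePoint θ)).injective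
  refine hi2.comp fun (a : ℝ) (b : ℝ) hab ↦ ?_
  set L : ℝ →L[ℝ] EuclideanSpace ℝ (Fin 1) := mfderiv 𝓘(ℝ, ℝ) (𝓡 1) circlePoint θ with hL
  have ha : L a = a • L 1 := by rw [← map_smul, smul_eq_mul, mul_one]
  have hb : L b = b • L 1 := by rw [← map_smul, smul_eq_mul, mul_one]
  have hab' : L a = L b := hab
  have h : (a - b) • L 1 = 0 := by rw [sub_smul, ← ha, ← hb, hab', sub_self]
  exact sub_eq_zero.1 ((smul_eq_zero.1 h).resolve_right (mfderiv_circlePoint_apply_ne_zero θ))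

/-! ### The collar sheet of a Seifert surface -/

variable (c : CapData S)

/-- **The collar half-sheet** of the Seifert surface `F` with capping data `c`:
`(t, θ) ↦ F (CS (z θ, t))`, the collar of `∂S` in `F(S)` parametrised by collar height `t ≥ 0` and
the angle `θ` of the knot (junk for `t < 0`). [folklore] -/
def halfSheet (hF : K.IsSpanningSurfaceOfGenus F e g) (p : ℝ × ℝ) : 𝔼 4 :=
  F (c.CS.toFun (hF.angleBd p.2) p.1)

/-- Unfolding of `halfSheet`. [folklore] -/
theorem halfSheet_apply (hF : K.IsSpanningSurfaceOfGenus F e g) (t θ : ℝ) :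
    hF.halfSheet c (t, θ) = F (c.CS.toFun (hF.angleBd θ) t) := rfl

/-- The parametrisation `(t, θ) ↦ (z θ, t)` of `∂S × ℝ` by the angle. [folklore] -/
def anglePar (hF : K.IsSpanningSurfaceOfGenus F e g) (p : ℝ × ℝ) : ↥((𝓡∂ 2).boundary S) × ℝ :=
  (hF.angleBd p.2, p.1)

/-- The angle parametrisation is smooth. [folklore] -/
theorem contMDiff_anglePar (hF : K.IsSpanningSurfaceOfGenus F e g) :
    ContMDiff 𝓘(ℝ, ℝ × ℝ) ((𝓡 1).prod 𝓘(ℝ, ℝ)) ∞ hF.anglePar :=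
  (hF.contMDiff_angleBd.comp contDiff_snd.contMDiff).prodMk contDiff_fst.contMDiff

/-- The half-sheet is `F ∘ collar ∘ anglePar`. [folklore] -/
theorem halfSheet_eq_comp (hF : K.IsSpanningSurfaceOfGenus F e g) :
    hF.halfSheet c = F ∘ uncurry c.CS.toFun ∘ hF.anglePar := rfl

/-- **The collar half-sheet is smooth on `[0, ∞) × ℝ`** (within the closed half plane). [folklore] -/
theorem contDiffOn_halfSheet (hF : K.IsSpanningSurfaceOfGenus F e g) :
    ContDiffOn ℝ ∞ (hF.halfSheet c) (Ici 0 ×ˢ univ) := by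
  rw [← contMDiffOn_iff_contDiffOn, halfSheet_eq_comp]
  refine hF.2.1.comp_contMDiffOn (c.CS.contMDiffOn_toFun.comp (hF.contMDiff_anglePar).contMDiffOn ?_)
  rintro ⟨t, θ⟩ ⟨ht, -⟩
  exact ⟨mem_univ _, ht⟩

/-- The half-sheet is `2π`-periodic in the angle. [folklore] -/
theorem halfSheet_add_two_pi (hF : K.IsSpanningSurfaceOfGenus F e g) (t θ : ℝ) :
    hF.halfSheet c (t, θ + 2 * Real.pi) = hF.halfSheet c (t, θ) := by
  rw [halfSheet_apply, halfSheet_apply, hF.periodic_angleBd]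

/-- At height `0` the half-sheet is the knot. [folklore] -/
theorem halfSheet_zero (hF : K.IsSpanningSurfaceOfGenus F e g) (θ : ℝ) :
    hF.halfSheet c (0, θ) = SphereEmbedding.curve K θ := by
  rw [halfSheet_apply, c.CS.apply_zero, BoundaryManifold.boundaryData_incl, hF.2.2.2.2.1,
    apply_angleBd, SphereEmbedding.curve_apply]

/-- For heights `t ≥ 0` the half-sheet lies on `𝕊³`. [folklore] -/
theorem norm_halfSheet (hF : K.IsSpanningSurfaceOfGenus F e g) (hF1 : ∀ x, ‖F x‖ = 1) (t θ : ℝ) :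
    ‖hF.halfSheet c (t, θ)‖ = 1 :=
  hF1 _

/-! #### Seeley extension across the knot -/

open Literature.Analysis.Calculus in
/-- **The collar sheet** of the Seifert surface: the half-sheet extended across the knot to
negative heights by Seeley's extension operator (R. T. Seeley, Proc. AMS 15 (1964)). [folklore] -/
def sheet (hF : K.IsSpanningSurfaceOfGenus F e g) : ℝ × ℝ → 𝔼 4 :=
  Seeley.extend 1 (hF.halfSheet c)

open Literature.Analysis.Calculus in
/-- On non-negative heights the sheet is the half-sheet. [folklore] -/
theorem sheet_of_nonneg (hF : K.IsSpanningSurfaceOfGenus F e g) {t : ℝ} (ht : 0 ≤ t) (θ : ℝ) :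
    hF.sheet c (t, θ) = hF.halfSheet c (t, θ) :=
  Seeley.extend_of_nonneg ht

open Literature.Analysis.Calculus in
/-- **The sheet is smooth on `(-∞, 1) × ℝ`** (Seeley's theorem, `Seeley.contDiffOn_extend`).
[folklore] -/
theorem contDiffOn_sheet (hF : K.IsSpanningSurfaceOfGenus F e g) :
    ContDiffOn ℝ ∞ (hF.sheet c) (Iio 1 ×ˢ univ) :=
  Seeley.contDiffOn_extend one_pos isOpen_univ ((hF.contDiffOn_halfSheet c).mono
    (prod_mono Ico_subset_Ici_self (subset_univ _)))

open Literature.Analysis.Calculus in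
/-- Seeley's extension of a function periodic in the parameter is periodic in the parameter.
[folklore] -/
theorem extend_add_of_forall {f : ℝ × ℝ → 𝔼 4} {T : ℝ} (hf : ∀ s θ, f (s, θ + T) = f (s, θ)) (δ t θ : ℝ) :
    Seeley.extend δ f (t, θ + T) = Seeley.extend δ f (t, θ) := by
  by_cases ht : 0 ≤ t
  · rw [Seeley.extend_of_nonneg (p := (t, θ + T)) ht, Seeley.extend_of_nonneg (p := (t, θ)) ht, hf]
  · rw [Seeley.extend_of_neg (p := (t, θ + T)) (not_le.1 ht), Seeley.extend_of_neg (p := (t, θ)) (not_le.1 ht)]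
    refine tsum_congr fun k ↦ ?_
    simp only [Seeley.term, Seeley.scale, ContinuousLinearMap.prod_apply, FunLike.coe_smul, Pi.smul_apply,
      ContinuousLinearMap.coe_fst', ContinuousLinearMap.coe_snd', smul_eq_mul]
    rw [hf]

/-- The sheet is `2π`-periodic in the angle. [folklore] -/
theorem sheet_add_two_pi (hF : K.IsSpanningSurfaceOfGenus F e g) (t θ : ℝ) :
    hF.sheet c (t, θ + 2 * Real.pi) = hF.sheet c (t, θ) :=
  extend_add_of_forall (hF.halfSheet_add_two_pi c) 1 t θ

/-- At height `0` the sheet is the knot. [folklore] -/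
theorem sheet_zero (hF : K.IsSpanningSurfaceOfGenus F e g) (θ : ℝ) :
    hF.sheet c (0, θ) = SphereEmbedding.curve K θ := by
  rw [hF.sheet_of_nonneg c le_rfl, halfSheet_zero]

/-- For heights `0 ≤ t` the sheet lies on `𝕊³`. [folklore] -/
theorem norm_sheet (hF : K.IsSpanningSurfaceOfGenus F e g) (hF1 : ∀ x, ‖F x‖ = 1) {t : ℝ}
    (ht : 0 ≤ t) (θ : ℝ) : ‖hF.sheet c (t, θ)‖ = 1 := by
  rw [hF.sheet_of_nonneg c ht, hF.norm_halfSheet c hF1]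

/-! #### The sheet is an immersion along the knot -/

/-- **Injectivity of the within-differential of the collar** `(z, t) ↦ CS (z, t)` at a boundary
point `(z, 0)`, within `∂S × [0, ∞)`: the collar has the smooth left inverse `(proj, height)` on
its open region. [folklore] -/
theorem mfderivWithin_collar_injective (z : (𝓡∂ 2).boundary S) :
    Injective (mfderivWithin ((𝓡 1).prod 𝓘(ℝ, ℝ)) (𝓡∂ 2) (uncurry c.CS.toFun)
      (univ ×ˢ Ici 0) (z, 0)) := by
  have hn : (∞ : WithTop ℕ∞) ≠ 0 := by simp
  set s : Set (↥((𝓡∂ 2).boundary S) × ℝ) := univ ×ˢ Ici 0 with hs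
  set Ψ : ↥((𝓡∂ 2).boundary S) × ℝ → S := uncurry c.CS.toFun with hΨ
  set Λ : S → ↥((𝓡∂ 2).boundary S) × ℝ := c.CS.projHeight with hΛ
  set q : ↥((𝓡∂ 2).boundary S) × ℝ := (z, 0) with hq
  have hqs : q ∈ s := ⟨mem_univ _, (le_rfl : (0 : ℝ) ≤ 0)⟩
  have hΨd : HasMFDerivWithinAt ((𝓡 1).prod 𝓘(ℝ, ℝ)) (𝓡∂ 2) Ψ s q
      (mfderivWithin ((𝓡 1).prod 𝓘(ℝ, ℝ)) (𝓡∂ 2) Ψ s q) :=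
    ((c.CS.contMDiffOn_toFun q hqs).mdifferentiableWithinAt hn).hasMFDerivWithinAt
  have hq' : Ψ q ∈ c.CS.region := c.CS.mem_region z 0 le_rfl
  have hΛd : HasMFDerivAt (𝓡∂ 2) ((𝓡 1).prod 𝓘(ℝ, ℝ)) Λ (Ψ q)
      (mfderiv (𝓡∂ 2) ((𝓡 1).prod 𝓘(ℝ, ℝ)) Λ (Ψ q)) :=
    ((c.CS.contMDiffOn_projHeight.contMDiffAt (c.CS.isOpen_region.mem_nhds hq')).mdifferentiableAt
      hn).hasMFDerivAt
  have hcomp : HasMFDerivWithinAt ((𝓡 1).prod 𝓘(ℝ, ℝ)) ((𝓡 1).prod 𝓘(ℝ, ℝ)) (Λ ∘ Ψ) s q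
      ((mfderiv (𝓡∂ 2) ((𝓡 1).prod 𝓘(ℝ, ℝ)) Λ (Ψ q)).comp
        (mfderivWithin ((𝓡 1).prod 𝓘(ℝ, ℝ)) (𝓡∂ 2) Ψ s q)) :=
    hΛd.comp_hasMFDerivWithinAt q hΨd
  have heq : ∀ p ∈ s, (Λ ∘ Ψ) p = p := fun p hp ↦ c.CS.projHeight_apply_toFun p.1 hp.2
  have hid : HasMFDerivWithinAt ((𝓡 1).prod 𝓘(ℝ, ℝ)) ((𝓡 1).prod 𝓘(ℝ, ℝ)) (Λ ∘ Ψ) s q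
      (ContinuousLinearMap.id ℝ _) :=
    (hasMFDerivWithinAt_id s q).congr_of_eventuallyEq
      (Filter.eventuallyEq_of_mem self_mem_nhdsWithin heq) (heq q hqs)
  have huniq : UniqueMDiffWithinAt ((𝓡 1).prod 𝓘(ℝ, ℝ)) s q :=
    (uniqueMDiffWithinAt_univ _).prod
      (uniqueMDiffWithinAt_iff_uniqueDiffWithinAt.2 (uniqueDiffOn_Ici 0 0 self_mem_Ici))
  have key := huniq.eq hcomp hid
  exact LeftInverse.injective (g := mfderiv (𝓡∂ 2) ((𝓡 1).prod 𝓘(ℝ, ℝ)) Λ (Ψ q))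
    fun v ↦ DFunLike.congr_fun key v

/-- **The differential of the angle parametrisation `(t, θ) ↦ (z θ, t)` is injective.** [folklore] -/
theorem mfderiv_anglePar_injective (hF : K.IsSpanningSurfaceOfGenus F e g) (p : ℝ × ℝ) :
    Injective (mfderiv 𝓘(ℝ, ℝ × ℝ) ((𝓡 1).prod 𝓘(ℝ, ℝ)) hF.anglePar p) := by
  have hn : (∞ : WithTop ℕ∞) ≠ 0 := by simp
  -- the two components
  have h1 : HasMFDerivAt 𝓘(ℝ, ℝ × ℝ) (𝓡 1) (hF.angleBd ∘ Prod.snd) p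
      ((mfderiv 𝓘(ℝ, ℝ) (𝓡 1) hF.angleBd p.2).comp (ContinuousLinearMap.snd ℝ ℝ ℝ)) := by
    have hs : HasMFDerivAt 𝓘(ℝ, ℝ × ℝ) 𝓘(ℝ, ℝ) (Prod.snd : ℝ × ℝ → ℝ) p
        (ContinuousLinearMap.snd ℝ ℝ ℝ) :=
      hasMFDerivAt_iff_hasFDerivAt.2 hasFDerivAt_snd
    exact ((hF.contMDiff_angleBd p.2).mdifferentiableAt hn).hasMFDerivAt.comp p hs
  have h2 : HasMFDerivAt 𝓘(ℝ, ℝ × ℝ) 𝓘(ℝ, ℝ) (Prod.fst : ℝ × ℝ → ℝ) p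
      (ContinuousLinearMap.fst ℝ ℝ ℝ) :=
    hasMFDerivAt_iff_hasFDerivAt.2 hasFDerivAt_fst
  have h := h1.prodMk h2
  rw [show hF.anglePar = fun p ↦ ((hF.angleBd ∘ Prod.snd) p, p.1) from rfl, h.mfderiv]
  intro v w hvw
  have h1' : mfderiv 𝓘(ℝ, ℝ) (𝓡 1) hF.angleBd p.2 v.2 = mfderiv 𝓘(ℝ, ℝ) (𝓡 1) hF.angleBd p.2 w.2 :=
    congrArg Prod.fst hvw
  have h2' : v.1 = w.1 := congrArg Prod.snd hvw
  exact Prod.ext h2' (hF.mfderiv_angleBd_injective p.2 h1')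

/-- **The sheet is an immersion along the knot**: `D(sheet) (0, θ)` is injective. On the closed
half plane `{t ≥ 0}` the sheet is `F ∘ collar ∘ anglePar`, whose within-differential is the
composite of three injective maps; the within-differential on the half plane is unique and equals
the full differential of the (smooth) sheet. [folklore] -/
theorem fderiv_sheet_injective (hF : K.IsSpanningSurfaceOfGenus F e g) (θ : ℝ) :
    Injective (fderiv ℝ (hF.sheet c) (0, θ)) := by
  have hn : (∞ : WithTop ℕ∞) ≠ 0 := by simp
  set T : Set (ℝ × ℝ) := Ici 0 ×ˢ univ with hT
  set s : Set (↥((𝓡∂ 2).boundary S) × ℝ) := univ ×ˢ Ici 0 with hs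
  set Ψ : ↥((𝓡∂ 2).boundary S) × ℝ → S := uncurry c.CS.toFun with hΨ
  set p₀ : ℝ × ℝ := (0, θ) with hp₀
  set q : ↥((𝓡∂ 2).boundary S) × ℝ := hF.anglePar p₀ with hq
  have hqs : q ∈ s := ⟨mem_univ _, (le_rfl : (0 : ℝ) ≤ 0)⟩
  have hmaps : MapsTo hF.anglePar T s := fun p hp ↦ ⟨mem_univ _, hp.1⟩
  -- the three differentials
  have hζd : HasMFDerivWithinAt 𝓘(ℝ, ℝ × ℝ) ((𝓡 1).prod 𝓘(ℝ, ℝ)) hF.anglePar T p₀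
      (mfderiv 𝓘(ℝ, ℝ × ℝ) ((𝓡 1).prod 𝓘(ℝ, ℝ)) hF.anglePar p₀) :=
    ((hF.contMDiff_anglePar p₀).mdifferentiableAt hn).hasMFDerivAt.hasMFDerivWithinAt
  have hΨd : HasMFDerivWithinAt ((𝓡 1).prod 𝓘(ℝ, ℝ)) (𝓡∂ 2) Ψ s q
      (mfderivWithin ((𝓡 1).prod 𝓘(ℝ, ℝ)) (𝓡∂ 2) Ψ s q) :=
    ((c.CS.contMDiffOn_toFun q hqs).mdifferentiableWithinAt hn).hasMFDerivWithinAt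
  have hFd : HasMFDerivAt (𝓡∂ 2) 𝓘(ℝ, 𝔼 4) F (Ψ q) (mfderiv (𝓡∂ 2) 𝓘(ℝ, 𝔼 4) F (Ψ q)) :=
    ((hF.2.1 (Ψ q)).mdifferentiableAt hn).hasMFDerivAt
  -- chain rule within the half plane
  have hchain : HasMFDerivWithinAt 𝓘(ℝ, ℝ × ℝ) 𝓘(ℝ, 𝔼 4) (F ∘ Ψ ∘ hF.anglePar) T p₀
      ((mfderiv (𝓡∂ 2) 𝓘(ℝ, 𝔼 4) F (Ψ q)).comp
        ((mfderivWithin ((𝓡 1).prod 𝓘(ℝ, ℝ)) (𝓡∂ 2) Ψ s q).comp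
          (mfderiv 𝓘(ℝ, ℝ × ℝ) ((𝓡 1).prod 𝓘(ℝ, ℝ)) hF.anglePar p₀))) :=
    hFd.comp_hasMFDerivWithinAt p₀ (hΨd.comp p₀ hζd hmaps)
  have hchain' : HasFDerivWithinAt (hF.halfSheet c)
      ((mfderiv (𝓡∂ 2) 𝓘(ℝ, 𝔼 4) F (Ψ q)).comp
        ((mfderivWithin ((𝓡 1).prod 𝓘(ℝ, ℝ)) (𝓡∂ 2) Ψ s q).comp
          (mfderiv 𝓘(ℝ, ℝ × ℝ) ((𝓡 1).prod 𝓘(ℝ, ℝ)) hF.anglePar p₀))) T p₀ :=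
    hasMFDerivWithinAt_iff_hasFDerivWithinAt.1 hchain
  -- the derivative of the sheet, within the half plane, is that of the half-sheet
  have hp₀T : p₀ ∈ Iio (1 : ℝ) ×ˢ (univ : Set ℝ) := ⟨(by norm_num : (0 : ℝ) < 1), mem_univ _⟩
  have hAd : HasFDerivAt (hF.sheet c) (fderiv ℝ (hF.sheet c) p₀) p₀ :=
    (((hF.contDiffOn_sheet c).contDiffAt ((isOpen_Iio.prod isOpen_univ).mem_nhds hp₀T)).differentiableAt
      (by simp)).hasFDerivAt
  have hAd' : HasFDerivWithinAt (hF.halfSheet c) (fderiv ℝ (hF.sheet c) p₀) T p₀ := by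
    refine hAd.hasFDerivWithinAt.congr_of_eventuallyEq ?_ ?_
    · filter_upwards [self_mem_nhdsWithin] with p hp
      exact (hF.sheet_of_nonneg c (t := p.1) hp.1 p.2).symm
    · exact (hF.sheet_of_nonneg c le_rfl θ).symm
  have hU : UniqueDiffWithinAt ℝ T p₀ :=
    (uniqueDiffOn_Ici 0).prod uniqueDiffOn_univ p₀ ⟨(le_rfl : (0 : ℝ) ≤ 0), mem_univ _⟩
  rw [hU.eq hAd' hchain']
  exact (hF.2.2.2.1 (Ψ q)).comp ((mfderivWithin_collar_injective c (hF.angleBd θ)).comp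
    (hF.mfderiv_anglePar_injective p₀))

end IsSpanningSurfaceOfGenus

end Knot


/-! ### The tube adapted to a Seifert surface -/

namespace Knot.IsSpanningSurfaceOfGenus

variable {K : Knot} {S : Type} [TopologicalSpace S] [ChartedSpace (EuclideanHalfSpace 2) S]
  [IsManifold (𝓡∂ 2) ∞ S] {F : S → 𝔼 4} {e : ↥((𝓡∂ 2).boundary S) ≃ₜ ↥(𝕊 1)} {g : ℕ}
  (c : CapData S)

/-- **The collar sheet of a Seifert surface** (`SphereEmbedding.CollarSheet`): Seeley's extension
of the collar half-sheet `(t, θ) ↦ F (CS (e⁻¹ (e^{iθ}), t))`. [folklore] -/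
def collarSheet (hF : K.IsSpanningSurfaceOfGenus F e g) (hF1 : ∀ x, ‖F x‖ = 1) :
    SphereEmbedding.CollarSheet K where
  A := hF.sheet c
  contDiffOn_A := (hF.contDiffOn_sheet c).mono (prod_mono Ioo_subset_Iio_self le_rfl)
  periodic_A := hF.sheet_add_two_pi c
  apply_zero := hF.sheet_zero c
  norm_A _ θ ht _ := hF.norm_sheet c hF1 ht θ
  fderiv_A_injective := hF.fderiv_sheet_injective c

/-- The sheet of `collarSheet` is `sheet`. [folklore] -/
@[simp] theorem collarSheet_A (hF : K.IsSpanningSurfaceOfGenus F e g) (hF1 : ∀ x, ‖F x‖ = 1) :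
    (hF.collarSheet c hF1).A = hF.sheet c := rfl

/-- **The tubular neighbourhood of `K` adapted to the Seifert surface `F`** (with respect to the
collar `c.CS` of `∂S`): Hirsch's tube over the positively oriented frame
`(γ', conormal of F(S), their natural normal)`, squeezed to an injectivity radius — an oriented
tubular neighbourhood of `K` whose positive `w₀`-half-planes are the collar of the knot in `F(S)`.
Hirsch (1976), §4.5 Thms. 5.1–5.2; §4.6 (collars and tubular neighbourhoods of neat
submanifolds). [cite: Hirsch1976, §4.5 Thm 5.2] -/
def adaptedTube (hF : K.IsSpanningSurfaceOfGenus F e g) (hF1 : ∀ x, ‖F x‖ = 1) : Knot.TubularNbhd K :=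
  (hF.collarSheet c hF1).tubularNbhd

/-- **The height profile of the adapted tube**: the collar height `ρ (x) ∈ [0, δ)` reached at
fibre coordinate `x e₀`, `x ≥ 0` (`ρ (x) = δ x / √(1 + x²)`). [folklore] -/
def adaptedHeight (hF : K.IsSpanningSurfaceOfGenus F e g) (hF1 : ∀ x, ‖F x‖ = 1) : ℝ → ℝ :=
  (hF.collarSheet c hF1).heightOf

/-- **The radius of the adapted tube** `δ > 0` (the supremum of its height profile). [folklore] -/
def adaptedRadius (hF : K.IsSpanningSurfaceOfGenus F e g) (hF1 : ∀ x, ‖F x‖ = 1) : ℝ :=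
  (hF.collarSheet c hF1).tubularRadius

/-- The radius of the adapted tube is positive. [folklore] -/
theorem adaptedRadius_pos (hF : K.IsSpanningSurfaceOfGenus F e g) (hF1 : ∀ x, ‖F x‖ = 1) :
    0 < hF.adaptedRadius c hF1 :=
  (hF.collarSheet c hF1).tubularRadius_pos

/-- The radius of the adapted tube is at most `1/4` (it is at most half the closeness height
`η ≤ 1/2`). [folklore] -/
theorem adaptedRadius_le (hF : K.IsSpanningSurfaceOfGenus F e g) (hF1 : ∀ x, ‖F x‖ = 1) :
    hF.adaptedRadius c hF1 ≤ 1 / 4 :=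
  (hF.collarSheet c hF1).tubularRadius_le_half_eta.trans (by
    linarith [(hF.collarSheet c hF1).eta_le_half])

/-- `ρ 0 = 0`. [folklore] -/
@[simp] theorem adaptedHeight_zero (hF : K.IsSpanningSurfaceOfGenus F e g) (hF1 : ∀ x, ‖F x‖ = 1) :
    hF.adaptedHeight c hF1 0 = 0 :=
  (hF.collarSheet c hF1).heightOf_zero

/-- `ρ (x) ≥ 0` for `x ≥ 0`. [folklore] -/
theorem adaptedHeight_nonneg (hF : K.IsSpanningSurfaceOfGenus F e g) (hF1 : ∀ x, ‖F x‖ = 1) {x : ℝ}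
    (hx : 0 ≤ x) : 0 ≤ hF.adaptedHeight c hF1 x :=
  (hF.collarSheet c hF1).heightOf_nonneg hx

/-- `|ρ (x)| < δ`. [folklore] -/
theorem abs_adaptedHeight_lt (hF : K.IsSpanningSurfaceOfGenus F e g) (hF1 : ∀ x, ‖F x‖ = 1) (x : ℝ) :
    |hF.adaptedHeight c hF1 x| < hF.adaptedRadius c hF1 :=
  (hF.collarSheet c hF1).abs_heightOf_lt x

/-- `ρ` is continuous. [folklore] -/
theorem continuous_adaptedHeight (hF : K.IsSpanningSurfaceOfGenus F e g) (hF1 : ∀ x, ‖F x‖ = 1) :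
    Continuous (hF.adaptedHeight c hF1) :=
  (hF.collarSheet c hF1).continuous_heightOf

/-- `ρ` is strictly monotone on `[0, ∞)`. [folklore] -/
theorem strictMonoOn_adaptedHeight (hF : K.IsSpanningSurfaceOfGenus F e g) (hF1 : ∀ x, ‖F x‖ = 1) :
    StrictMonoOn (hF.adaptedHeight c hF1) (Ici 0) :=
  (hF.collarSheet c hF1).strictMonoOn_heightOf

/-- The explicit formula `ρ (x) = δ (√(1 + x²))⁻¹ x`. [folklore] -/
theorem adaptedHeight_eq (hF : K.IsSpanningSurfaceOfGenus F e g) (hF1 : ∀ x, ‖F x‖ = 1) (x : ℝ) :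
    hF.adaptedHeight c hF1 x = hF.adaptedRadius c hF1 * (√(1 + x ^ 2))⁻¹ * x := rfl

/-- **`ρ` maps `[0, ∞)` onto `[0, δ)`** (intermediate value theorem: `ρ (x) → δ`). [folklore] -/
theorem exists_adaptedHeight_eq (hF : K.IsSpanningSurfaceOfGenus F e g) (hF1 : ∀ x, ‖F x‖ = 1) {t : ℝ}
    (ht0 : 0 ≤ t) (ht : t < hF.adaptedRadius c hF1) : ∃ x, 0 ≤ x ∧ hF.adaptedHeight c hF1 x = t := by
  set δ := hF.adaptedRadius c hF1 with hδ
  have hδ0 : 0 < δ := hF.adaptedRadius_pos c hF1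
  -- a large `X` with `ρ (X) > t`: `ρ (X) = δ X / √(1 + X²) ≥ δ X / (1 + X)`, take `X = t / (δ - t) + 1`
  obtain ⟨X, hX0, hXt⟩ : ∃ X : ℝ, 0 ≤ X ∧ t ≤ hF.adaptedHeight c hF1 X := by
    rcases eq_or_lt_of_le ht0 with rfl | ht0'
    · exact ⟨0, le_rfl, by rw [adaptedHeight_zero]⟩
    set X : ℝ := (t / (δ - t)) ^ 2 + t / (δ - t) with hXdef
    have hq : 0 < t / (δ - t) := div_pos ht0' (by linarith)
    have hX : 0 < X := by positivity
    refine ⟨X, hX.le, ?_⟩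
    rw [adaptedHeight_eq]
    -- `δ X / √(1+X²) ≥ t ⟸ δ² X² ≥ t² (1 + X²) ⟸ (δ² - t²) X² ≥ t²`, true as `X ≥ t/(δ-t) ≥ t/√(δ²-t²)`
    have hs : 0 < √(1 + X ^ 2) := Real.sqrt_pos.2 (by positivity)
    rw [show δ * (√(1 + X ^ 2))⁻¹ * X = δ * X / √(1 + X ^ 2) by ring, le_div_iff₀ hs]
    have h1 : 0 ≤ δ * X := by positivity
    have h2 : 0 ≤ t * √(1 + X ^ 2) := by positivity
    suffices hsq : (t * √(1 + X ^ 2)) ^ 2 ≤ (δ * X) ^ 2 by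
      by_contra hcon
      push Not at hcon
      nlinarith [mul_self_lt_mul_self h1 hcon]
    rw [mul_pow, Real.sq_sqrt (by positivity), mul_pow]
    have hXq : t / (δ - t) ≤ X := by rw [hXdef]; nlinarith
    have hne : δ - t ≠ 0 := (sub_pos.2 ht).ne'
    have hkey : t ≤ (δ - t) * X := by
      calc t = (δ - t) * (t / (δ - t)) := by rw [mul_div_cancel₀ _ hne]
        _ ≤ (δ - t) * X := mul_le_mul_of_nonneg_left hXq (by linarith)
    nlinarith [mul_nonneg ht0 hX.le, sq_nonneg X, hkey, mul_pos hδ0 hX]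
  -- intermediate value theorem on `[0, X]`
  have hcont : ContinuousOn (hF.adaptedHeight c hF1) (Icc 0 X) :=
    (hF.continuous_adaptedHeight c hF1).continuousOn
  have hmem : t ∈ Icc (hF.adaptedHeight c hF1 0) (hF.adaptedHeight c hF1 X) := by
    rw [adaptedHeight_zero]; exact ⟨ht0, hXt⟩
  obtain ⟨x, hx, hxt⟩ := intermediate_value_Icc hX0 hcont hmem
  exact ⟨x, hx.1, hxt⟩

/-- The base vector `e₀ = ½ (1, 0)` of the framing curves is `½ e₀` on the `w₀`-axis. [folklore] -/
theorem framingBaseVector_eq_single :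
    framingBaseVector = EuclideanSpace.single (0 : Fin 2) (1 / 2 : ℝ) := by
  rw [framingBaseVector, euclideanSpace_single_eq_smul]
  congr 1
  ext i
  fin_cases i <;> simp [circlePoint]

/-- **The adapted tube is the Seifert surface on the positive `w₀`-half-planes**: for every
boundary point `z` and `x ≥ 0`, `ν (e z, x e₀) = F (CS (z, ρ x))` — the fibre half-line over the
knot point `K (e z)` in the direction `e₀` is the collar line of `∂S` through `z`, reparametrised
by the height profile `ρ`. [folklore] -/
theorem adaptedTube_apply_single (hF : K.IsSpanningSurfaceOfGenus F e g) (hF1 : ∀ x, ‖F x‖ = 1)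
    (z : (𝓡∂ 2).boundary S) {x : ℝ} (hx : 0 ≤ x) :
    ((hF.adaptedTube c hF1 (e z, EuclideanSpace.single 0 x) : 𝕊 3) : 𝔼 4) =
      F (c.CS.toFun z (hF.adaptedHeight c hF1 x)) := by
  obtain ⟨θ, hθ⟩ := circlePoint_surjective (e z)
  have hz : hF.angleBd θ = z := by
    rw [angleBd_apply, hθ, Homeomorph.symm_apply_apply]
  rw [← hθ, adaptedTube, SphereEmbedding.CollarSheet.tubularNbhd_circlePoint_single_zero _ hx,
    collarSheet_A, hF.sheet_of_nonneg c ((hF.collarSheet c hF1).heightOf_nonneg hx), halfSheet_apply, hz]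
  rfl

/-- **The longitude of the adapted tube runs in the Seifert surface**: it is the collar loop of
height `ρ (1/2)` over the boundary loop `t ↦ e⁻¹ (e^{2πit})`. [folklore] -/
theorem coe_longitude_adaptedTube (hF : K.IsSpanningSurfaceOfGenus F e g) (hF1 : ∀ x, ‖F x‖ = 1)
    (t : unitInterval) :
    (((hF.adaptedTube c hF1).longitude t : 𝕊 3) : 𝔼 4) =
      F (c.CS.toFun (e.symm (circlePoint (2 * Real.pi * t))) (hF.adaptedHeight c hF1 (1 / 2))) := by
  rw [Knot.TubularNbhd.coe_longitude_apply, framingBaseVector_eq_single,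
    ← hF.adaptedTube_apply_single c hF1 _ (by norm_num : (0 : ℝ) ≤ 1 / 2), Homeomorph.apply_symm_apply]

/-- The height `ρ (1/2)` of the longitude is in `(0, 1/4)`. [folklore] -/
theorem adaptedHeight_half_mem (hF : K.IsSpanningSurfaceOfGenus F e g) (hF1 : ∀ x, ‖F x‖ = 1) :
    0 < hF.adaptedHeight c hF1 (1 / 2) ∧ hF.adaptedHeight c hF1 (1 / 2) < 1 / 4 := by
  constructor
  · have h := hF.strictMonoOn_adaptedHeight c hF1 (self_mem_Ici) (by norm_num : (0 : ℝ) ≤ 1 / 2)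
      (by norm_num : (0 : ℝ) < 1 / 2)
    rwa [adaptedHeight_zero] at h
  · exact ((le_abs_self _).trans_lt (hF.abs_adaptedHeight_lt c hF1 _)).trans_le
      (hF.adaptedRadius_le c hF1)

/-! #### Away from the collar the surface avoids a thin tube -/

/-- The open sub-collar `{y ∈ region | height y < s}` of `S`. [folklore] -/
theorem isOpen_region_inter_height_lt (s : ℝ) : IsOpen (c.CS.region ∩ {y | c.CS.height y < s}) :=
  c.CS.continuousOn_height.isOpen_inter_preimage c.CS.isOpen_region isOpen_Iio

/-- **Off a sub-collar, the Seifert surface keeps away from a thin tube about the knot.** For every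
`s₁ > 0` there is `r > 0` such that no point of `S` outside the open sub-collar of height `< s₁`
is mapped by `F` into the tube `ν (𝕊¹ × B (0, r))` of the adapted tube: the image of that compact
set misses the knot (interior points miss it, boundary points lie in the sub-collar), and `ν` is
uniformly close to the knot on thin tubes (tube lemma over the compact circle). [folklore] -/
theorem exists_radius_forall_ne (hF : K.IsSpanningSurfaceOfGenus F e g) (hF1 : ∀ x, ‖F x‖ = 1)
    [CompactSpace S] {s₁ : ℝ} (hs₁ : 0 < s₁) :
    ∃ r : ℝ, 0 < r ∧ ∀ y : S, ¬ (y ∈ c.CS.region ∧ c.CS.height y < s₁) →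
      ∀ (u : 𝕊 1) (w : 𝔼 2), ‖w‖ < r → ((hF.adaptedTube c hF1 (u, w) : 𝕊 3) : 𝔼 4) ≠ F y := by
  set ν := hF.adaptedTube c hF1 with hν
  set C : Set (𝔼 4) := F '' {y | ¬ (y ∈ c.CS.region ∧ c.CS.height y < s₁)} with hC
  have hCc : IsCompact C := ((isOpen_region_inter_height_lt c s₁).isClosed_compl.isCompact).image
    hF.2.1.continuous
  -- `C` misses the knot
  have hCK : ∀ u : 𝕊 1, ((K u : 𝕊 3) : 𝔼 4) ∉ C := by
    rintro u ⟨y, hy, hyu⟩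
    apply hy
    -- `y` is the boundary point `e⁻¹ u`
    have hy' : y = ((e.symm u : (𝓡∂ 2).boundary S) : S) := by
      apply hF.2.2.1
      rw [hyu, hF.2.2.2.2.1 (e.symm u), Homeomorph.apply_symm_apply]
    subst hy'
    refine ⟨?_, ?_⟩
    · exact c.CS.boundary_subset_region (e.symm u).property
    · rw [show ((e.symm u : (𝓡∂ 2).boundary S) : S) = (BoundaryManifold.boundaryData 1 S).incl (e.symm u)
        from rfl, c.CS.height_incl]
      exact hs₁
  -- the open set of good fibre points, containing the zero section
  set G : Set ((𝕊 1) × 𝔼 2) := {p | ((ν p : 𝕊 3) : 𝔼 4) ∉ C} with hG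
  have hGo : IsOpen G := by
    have hcont : Continuous fun p : (𝕊 1) × 𝔼 2 ↦ ((ν p : 𝕊 3) : 𝔼 4) :=
      continuous_subtype_val.comp ν.isSmoothEmbedding_coe.isEmbedding.continuous
    exact hCc.isClosed.isOpen_compl.preimage hcont
  have hsub : (univ : Set (𝕊 1)) ×ˢ ({0} : Set (𝔼 2)) ⊆ G := by
    rintro ⟨u, w⟩ ⟨-, hw⟩
    rw [mem_singleton_iff] at hw
    subst hw
    show ((ν (u, 0) : 𝕊 3) : 𝔼 4) ∉ C
    rw [Knot.TubularNbhd.coe_apply_zero]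
    exact hCK u
  obtain ⟨U, V, -, hV, hU, h0V, hUV⟩ :=
    generalized_tube_lemma isCompact_univ isCompact_singleton hGo hsub
  obtain ⟨r, hr, hball⟩ := Metric.isOpen_iff.1 hV 0 (h0V rfl)
  refine ⟨r, hr, fun y hy u w hw heq ↦ ?_⟩
  have hmem : (u, w) ∈ G := hUV ⟨hU (mem_univ u), hball (by simpa using hw)⟩
  exact hmem ⟨y, hy, heq.symm⟩

/-- **In a thin tube about the knot, the Seifert surface is exactly the positive `w₀`-half-planes
of the adapted tube.** There is `r > 0` such that a point `F y` of the surface lies in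
`ν (𝕊¹ × B (0, r))` only if it is `ν (u, x e₀)` with `x ≥ 0` (and then `y` is the collar point
`CS (e⁻¹ u, ρ x)`). [folklore] -/
theorem exists_radius_forall_eq_single (hF : K.IsSpanningSurfaceOfGenus F e g)
    (hF1 : ∀ x, ‖F x‖ = 1) [CompactSpace S] :
    ∃ r : ℝ, 0 < r ∧ ∀ (y : S) (u : 𝕊 1) (w : 𝔼 2), ‖w‖ < r →
      ((hF.adaptedTube c hF1 (u, w) : 𝕊 3) : 𝔼 4) = F y →
        ∃ x : ℝ, 0 ≤ x ∧ w = EuclideanSpace.single 0 x ∧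
          y = c.CS.toFun (e.symm u) (hF.adaptedHeight c hF1 x) := by
  set ν := hF.adaptedTube c hF1 with hν
  set δ := hF.adaptedRadius c hF1 with hδ
  obtain ⟨r, hr, hfar⟩ := hF.exists_radius_forall_ne c hF1 (half_pos (hF.adaptedRadius_pos c hF1))
  refine ⟨r, hr, fun y u w hw heq ↦ ?_⟩
  -- `y` lies in the sub-collar of height `< δ/2`
  have hy : y ∈ c.CS.region ∧ c.CS.height y < δ / 2 := by
    by_contra h
    exact hfar y h u w hw heq
  -- write its height as `ρ x`
  obtain ⟨x, hx0, hx⟩ := hF.exists_adaptedHeight_eq c hF1 (c.CS.height_nonneg y hy.1)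
    (hy.2.trans (half_lt_self (hF.adaptedRadius_pos c hF1)))
  set z : (𝓡∂ 2).boundary S := c.CS.proj y with hz
  have hyz : y = c.CS.toFun z (hF.adaptedHeight c hF1 x) := by
    rw [hx]; exact (c.CS.apply_proj_height y hy.1).symm
  -- so `F y = ν (e z, x e₀)`, and `ν` is injective
  have h1 : ((ν (e z, EuclideanSpace.single 0 x) : 𝕊 3) : 𝔼 4) = F y := by
    rw [hyz]; exact hF.adaptedTube_apply_single c hF1 z hx0
  have h2 : ν (u, w) = ν (e z, EuclideanSpace.single 0 x) :=
    Subtype.ext (heq.trans h1.symm)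
  have h3 := ν.isSmoothEmbedding_coe.isEmbedding.injective h2
  obtain ⟨rfl, rfl⟩ := Prod.mk_inj.1 h3
  exact ⟨x, hx0, rfl, by rw [Homeomorph.symm_apply_apply]; exact hyz⟩

end Knot.IsSpanningSurfaceOfGenus

end Literature.Topology.FourManifolds
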